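import Mathlib
import Summits.CriticalPhenomena.SAWScalingLimit.Theses.SAWDefectDecoherence
import Summits.CriticalPhenomena.SAWScalingLimit.Theses.SAWPhaseRetrieval
import Summits.CriticalPhenomena.SAWScalingLimit.Theses.SAWWindingAlias
import Summits.CriticalPhenomena.SAWScalingLimit.Theses.SAWResidueField
import Summits.CriticalPhenomena.SAWScalingLimit.Theses.SAWDevelopingMap
import Summits.CriticalPhenomena.SAWScalingLimit.Theorems.ObservableToSLE.Negative.TightnessNecessity
import Summits.CriticalPhenomena.SAWScalingLimit.Theorems.ObservableToSLE.Negative.Identification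
import Summits.CriticalPhenomena.SAWScalingLimit.Theorems.ObservableToSLE.Negative.FirstStepSilence
import Summits.CriticalPhenomena.SAWScalingLimit.Theorems.ObservableToSLE.Negative.HypothesisSilence
import Summits.CriticalPhenomena.SAWScalingLimit.Theorems.ObservableToSLE.Negative.EndpointNecessity
import Summits.CriticalPhenomena.SAWScalingLimit.Theorems.BoundaryClosureNegative_Instance

/-!
# Disproof of `ObservableToSLER` (crux stmt-CriticalPhenomena-14005) — findings

Standing adversary file (refuter `cdisprove`; gen 1 wrote §1–§7, gen 2 / cycle 2 wrote §8–§13)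
for the glue crux

  `ObservableToSLER : HexObservableLimitR → HexTight → ⟨DCS 2012 Conjecture 1, typed⟩`

shared by the routes SAWDefectDecoherence / SAWPhaseRetrieval / SAWResidueField (decl
`ObservableToSLER`) and SAWWindingAlias (decl `ObservableToSLE`), and — finding §1 — LITERALLY THE
SAME STATEMENT as item stmt-CriticalPhenomena-10472 (`SAWDevelopingMap.ObservableToSLE`, whose
antecedent `SAWDevelopingMap.HexObservableLimit` now carries item 14003 = `HexObservableLimitR`;
its own standing file `Cruxes/ObservableToSLE/Disproof.lean`, cycle 4, and the landed
`Theorems/ObservableToSLE/Negative/*` apply here verbatim).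
Everything below is a checked theorem (rc 0, NO `sorry`); prose lives in docstrings only.

LANDED under `Summits/CriticalPhenomena/SAWScalingLimit/Theorems/ObservableToSLER/Negative/`:

| module | proposal | content |
|---|---|---|
| `Negative.RootPinNecessity` | p72543 ✓ | §5: `HexObservableLimitRootFree`, `obsLimitR_of_rootFree`, `not_rootFree`, `observableToSLER_withRootFreeHyp` |
| `Negative.NormalisationDrift` | p72591 ✓ | §6–§7: `itoDrift`, `ratioDrift_eq`, `ratioDrift_ne_zero`, `tendsto_ratioDrift_atTop`, `canonical_halfLattice_height_zero`, `canonical_not_halfLattice`, `tendsto_splitMesh` |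
| `Negative.OrientationSilence` | p77126 ✓ (cycle 2) | §8–§9: `FlatAt`, `rFlat_false_of_flatAt`, `obsLimitRBody_of_flatAt(_rootOfUnity)`, `IsFlatPinnedWith`, `obsLimitRBody_of_relativeClass_ne`, `obsLimitR_iff_untilted`, `CruxPerDomain`, `perDomain_disc`, `perDomain_tilted` |
| `Negative.RootRenewalDefects` | p77320 (cycle 2, pending) + `Negative.NotRootRenewal` (to follow) | §10/§12: `isRenewalRowList_iff_of_getLast_lt`, `not_isRenewalRowList_of_high_then_low`, `noRenewal_iff_reaches_top`, `noRenewalObs_eq_of_forcedU`, `rr_ineq_false_of_forcedU`, `Z_pos_of_nonempty` |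

and, from the sibling seat on the duplicate item 10472, `Theorems/ObservableToSLE/Negative/*`
(NoCutPoint, EndpointNecessity, Identification, HypothesisSilence, TightnessNecessity,
FirstStepSilence, CompactContainer, RootSilence, DeepEndpoints, HalfDiscMesh, FloorClassNonVacuity,
AdmissibleInstance) — all apply verbatim by `same_statement_as_item_10472`.

## Verdict (cycles 1–2): NO KILL — and why it resists

`¬ ObservableToSLER ↔ HexObservableLimitR ∧ HexTight ∧ ¬ HexConjecture` (`not_crux_iff`).  A
refutation must PROVE the ψ-averaged, two-point flat-pinned DCS Conjecture 2 (item 14003, open),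
PROVE eventual tightness of the critical hexagonal SAW (item 5423, open) and DISPROVE DCS
Conjecture 1 as typed (item 0808) — which is not junk-refutable (landed
`Negative.EndpointNecessity`, `HexConjecture/Negative/*`: the conclusion forces exactly its own
hypothesis structure, the laws are honest probability measures eventually, `CurveClass ℂ` is
Polish).  The crux is implied by its own conclusion (`of_conclusion`), so no
`_false_without_<H>` theorem can exist for either hypothesis (§2).  Cycle 2 re-audited the
antecedent `R` for junk-FALSITY (which would make the crux vacuously true): none found — `F(b_δ) ≠ 0`
for boundary `a_δ, b_δ` of a simply connected `Λ_δ` (deterministic winding), the limit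
`(Φ′/Φ′(b))^{5/8}` is scale- and branch-invariant, overlapping balls only void instances, the
corridor witness of 5420 is blocked by the rigid root ball (§5); so `R` stands or falls with DCS
Conjecture 2 itself.

## Index of findings (for provers / planners / the lead of the gate line)

* §1 SHAPE.  `crux_iff`, `of_conclusion`, `not_crux_iff`; the four route copies are `Iff.rfl`;
  **`same_statement_as_item_10472`**: `ObservableToSLER ↔ SAWDevelopingMap.ObservableToSLE` by
  `Iff.rfl` — items 14005 and 10472 are ONE statement filed twice (planners: dedup; every landed
  `Theorems/ObservableToSLE/Negative/*` lemma applies verbatim here).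
* §2 LOAD-BEARING ANALYSIS.  `ObservableToSLERWithoutObsLimit` (= `HexTight → HexConjecture`) and
  `ObservableToSLERWithoutTight` (= `HexObservableLimitR → HexConjecture`) are both implied by
  `HexConjecture`; W5 port: `withoutTight_iff` — dropping `HexTight` costs exactly
  `HexObservableLimitR → HexTight` (tightness is a CONSEQUENCE of the conclusion,
  `hexTight_of_hexConjecture`), so a line avoiding `HexTight` proves it on the way.
* §3 THE CRUX IS EXACTLY IDENTIFICATION: `crux_iff_identification` (soft half PROVED in the tree:
  Prokhorov + discharged uniqueness of the SLE law; `HexTight` enters only through Prokhorov).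
* §4 SILENCE OF THE HYPOTHESIS where the conclusion lives.  `ObsLimitRBody c D` names the
  per-domain content of `HexObservableLimitR` (`obsLimitR_iff_body`); it is PROVABLE OUTRIGHT on the
  unit disc for every constant `c` (`obsLimitRBody_unitDisc`, the two-point flat premise being
  false there, `two_point_flat_premise_false_on_unitDisc`), i.e. `HexObservableLimitR` carries no
  information on `(𝔻; 1, −1)`, where `HexConjecture` must nevertheless be proved; and it is silent
  on every slit domain `Ω ∖ γ[0,1]` of the martingale scheme after ONE step
  (`slitSegment_ne_carrier`, re-exported).  The flat-pinned → rough-root, Jordan → slit,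
  per-domain → Carathéodory-uniform bootstrap of Conjecture 2 is therefore INSIDE this item.
* §5 THE ROOT PIN IS THE ONLY THING BETWEEN `HexObservableLimitR` AND A REFUTED STATEMENT.
  `HexObservableLimitRootFree` := the hypothesis with the two root clauses (flat ball at `pt 0`,
  exact half-lattice at `pt 0`) deleted = the refuted item 5420 verbatim; `obsLimitR_of_rootFree`
  (it is a strengthening of `HexObservableLimitR`) and **`not_rootFree`** (FALSE: the corridor
  witness of `SAWDefectDecoherenceHexObservableLimit_refuted`, replayed on the landed
  `BoundaryClosureNegative_*` engine).  MORAL: the bootstrap target inside the crux ("Conj. 2 with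
  a rough root") can NOT be the root-free averaged statement — any admissible rough-root form must
  keep lattice control at the root (canonical discretisation at the tip, which the SAW's own slit
  domains have automatically); and the crux with its hypothesis strengthened to the root-free form
  is vacuously true (`crux_withRootFreeHyp`), so that strengthening is worthless.
* §6 MECHANISM ALGEBRA (Itô).  `itoDrift_eq_zero_iff`: `g′^α (g − W)^β` with `(α, β) = (5/8, −5/4)`
  is driftless iff `κ = 8/3`; **`ratioDrift_eq`** / `ratioDrift_ne_zero`: the observable
  normalised at a boundary point `u` that is NOT the SLE target has drift
  `(25/6)(X − U)/(X U²) ≠ 0` — the `b`-normalisation is load-bearing AND works only because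
  `b = pt 1` is the target of the curve (hydrodynamic tangency `U → ∞` kills the drift).
* §7 DICTIONARY GAP (lattice).  The exact-half-lattice clause of `HexObservableLimitR` versus the
  CANONICAL discretisation `hexSAWLaw` lives on: at height `0` the canonical discretisation is the
  exact half-lattice (`canonical_halfLattice_height_zero`), but a flat piece at ANY height `y > 0`
  splits a lattice row along meshes `δ_k → 0⁺` (`canonical_not_halfLattice`): for such marked
  points `HexObservableLimitR` never speaks about `Ω_δ` itself along that sequence.
* §8 (cycle 2) ORIENTATION SILENCE — S1 IS LOAD-BEARING FOR THE GATE LINE.  `FlatAt D i u ρ`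
  (flat piece at `pt i` with inner normal `u·I`; `u = 1` is verbatim `R`'s ball clause,
  `flatAt_one_iff`).  **`rFlat_false_of_flatAt`**: a flat piece of ANY other unit orientation
  `u ≠ 1` at `pt i` falsifies `R`'s class-`1` clause at EVERY radius (witness `pt i + t·I(1 − u)`),
  hence `ObsLimitRBody c D` holds outright for every `c` (`obsLimitRBody_of_flatAt`,
  `…_rootOfUnity` for `u⁶ = 1`).  With card 3's `IsFlatPinned D ρ ↔ ∃ u, IsFlatPinnedWith D u ρ`
  (`isFlatPinned_iff`): of the 36 orientation pairs of K2 (`TwoPieceFloorIdentification` /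
  `FloorIdU`), `R` binds exactly `(1, 1)` (`isFlatPinnedWith_one_iff`,
  `obsLimitRBody_of_isFlatPinnedWith`); every pair of NONZERO RELATIVE CLASS is free
  (`obsLimitRBody_of_relativeClass_ne`) and no global lattice symmetry reaches it; co-tilted pairs
  `(u, u)` need the (provable, but untyped in `R`) 60°-rotation covariance of `hexSAWLaw`,
  `hexParafermionicObservable`, `Φ`, `ψ` AND of the row clause `m ≤ v.1 1` (which becomes a
  `rowCoord`-family clause).  `obsLimitR_iff_untilted`: `R` ↔ `R` restricted to domains with no
  tilted/flipped flat piece.  For (𝔻; −i, i)-type targets every gate pair has nonzero relative class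
  (TRIAGE r1-2/3), so S1 `OrientationTransfer` — or a planner re-typing of item 14003's two ball
  clauses with independent orientations `u_i⁶ = 1` (immune to the 5420 corridor witness for the same
  reason `R` is: the root ball stays rigid) — is a crux-rank stub of the merged gate line.
* §9 (cycle 2) THE CRUX IS IRREDUCIBLY A TRANSFER STATEMENT.  `CruxPerDomain` (content of `R` at
  `D` + `HexTight` ⇒ Conj. 1 at `D`) implies the crux (`crux_of_perDomain`) but contains
  `HexTight → Conj. 1` on the disc and on every tilted two-piece domain with NO observable input
  (`perDomain_disc`, `perDomain_tilted`; `perDomain_iff`): no line may consume `R` only at the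
  target domain; `R` on the co-oriented flat class must be transported (restriction / renewal /
  Radó) to where `R` says nothing.
* §10 (cycle 2) `RootRenewal` (card 1's typed input) — the two defects, CHECKED at list level:
  vacuous splits (`isRenewalRowList_of_forall_lt/ge`); (a) low target ⇒ typed renewal at `h` iff
  the walk never reaches row `h` (`isRenewalRowList_iff_of_getLast_lt`), so over a window below
  which the target lies `noRenewalObs` is EXACTLY the mass reaching the window top
  (`noRenewal_iff_reaches_top`); (b) forced U-profile ⇒ `noRenewalObs = F(z)`
  (`not_isRenewalRowList_of_high_then_low`, `noRenewalObs_eq_of_forcedU`) and RR's inequality fails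
  for every `ε < 1` once a walk exists (`rr_ineq_false_of_forcedU`, `Z_pos_of_nonempty`); and
  §12 realises the forcing domain for arbitrary `R₀, K` in lattice coordinates:
  **`not_rootRenewal : ¬ RootRenewal`** (checked, no sorry).  AUDIT OF THE SURVIVING FIRST LEMMAS (no theorem needed): card 3's
  `RenewalFactorisation` and card 2's `GateFactorisation` are correct AS TYPED, including the junk
  regimes of `HexMidEdgeSAW` (non-edge `b`, `a = b`, trivial walk: `eq_of_nil` and the exclusions
  `a ≠ s(p,q) ≠ b` resp. `a ∌ Λb`, `z ∌ Λa` dispose of them; `length = #verts` is additive;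
  `edges_nodup` splits and re-joins because inner edges of the halves live inside `S`/`Λ ∖ S`).
  AUDIT OF `RenewalAccumulation` (RA, the load-bearing input of the merged gate line): no junk
  instance found — `r ≤ 1` forced but free, `innerComponent ∋ c`, `q ∈ Ω_δ ∖ hexBall` forced by
  `HasCleanWindow` + maximality of the component, each lattice edge crosses exactly one `rowCoord`
  family (so the `σ (rowCoord i q − rowCoord i p) = 1` clause is always satisfiable), the window
  radius `ρ` is chosen after `r` (cusps harmless), simply connected `D` cannot force a double visit
  of the `c`-component (a self-touching corridor would enclose a region of `D`).  Its lattice core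
  is a BET on non-slowly-varying irreducible-bridge height tails at `x_c` (index `3/4` expected,
  Alberts–Duminil-Copin 2010 in the continuum; a slowly varying tail would void `[r, √r]` windows
  with probability bounded below) — open, consistent with everything known; no cheap kill.
* §11 Targets: none (no line picked).  §12 (cycle 2) **`RootRenewal` IS FALSE**: the forcing domain
  (slanted box + top row + slanted down column in `fj` coordinates), `simplyConnected_Lam`,
  `patch_clause`, `far_clause`, `forcedU`, `nonempty_saw`, **`not_rootRenewal`** — all checked.
  Near-misses: none.
* §13 (cycle 2) PLANNER AID: the orientation-complete hypothesis **`HexObservableLimitR6`** (item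
  14003's body with independent orientations `k : Fin 2 → Fin 6`, unit `ζ^{k i}`, flat piece
  `FlatAt`, half-lattice clause in the cut row family `orientFamily`/`orientSign`), TYPED AND
  ELABORATING; `obsLimitR6Body_zero_iff` (its co-oriented instance is `R`'s body),
  `obsLimitR_of_R6 : R6 → R`, `cruxR6_of_crux` (the crux re-filed over `R6` is the weaker item and
  deletes S1), `flatAt_zeta_three` (`k = 3` is the ceiling class `u = −1`, e.g. DCS's strip `S_T`
  bottom-to-top, on which `R` is silent).
-/

noncomputable section

open Literature.Probability.RandomPlanarGeometry Literature.Probability.RandomPlanarGeometry.SAW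
  Literature.Probability.LatticeModels MeasureTheory Filter Topology Set
open scoped NNReal ENNReal

namespace Summit.CriticalPhenomena.SAWScalingLimit.Cruxes.ObservableToSLER.Disproof

/-! **buildfix 2026-08-19 (ops-buildfix lane).** Route `SAWDefectDecoherence` DROPPED its decl `HexConjecture` at rev 17
(2026-08-16) and inlined its body into the crux `ObservableToSLER`; the 16 references of this work file to
`SAWDefectDecoherence.HexConjecture` now read `SAWDevelopingMap.HexConjecture` — the byte-identical body still declared by the
imported route `SAWDevelopingMap` (DCS 2012 Conjecture 1 as typed), so every `Iff.rfl` below is unchanged in meaning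
(`hexConjecture_iff_developingMap` in §1 becomes the trivial `A ↔ A`). Nothing else was touched. -/

open Summit.CriticalPhenomena.SAWScalingLimit.Theses
open Summit.CriticalPhenomena.SAWScalingLimit.Theorems.ObservableToSLE.Negative

/-! ## §1 Logical shape of the crux; the item is filed twice -/

/-- The crux is literally `HexObservableLimitR → HexTight → HexConjecture`. -/
theorem crux_iff :
    SAWDefectDecoherence.ObservableToSLER ↔
      (SAWDefectDecoherence.HexObservableLimitR → SAWDefectDecoherence.HexTight →
        SAWDevelopingMap.HexConjecture) :=
  Iff.rfl

/-- The conclusion of the crux is verbatim the registered open conjecture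
`Literature…SAW.HexSAWScalingLimit` (DCS 2012 Conjecture 1), i.e. item `HexConjecture` (0808). -/
theorem conclusion_iff_hexSAWScalingLimit :
    SAWDevelopingMap.HexConjecture ↔ HexSAWScalingLimit := Iff.rfl

/-- The crux is implied by its own conclusion (DCS Conjecture 1 as typed). -/
theorem of_conclusion (h : SAWDevelopingMap.HexConjecture) :
    SAWDefectDecoherence.ObservableToSLER :=
  fun _ _ => h

/-- What a refutation would have to deliver: BOTH open antecedents AND the negation of DCS
Conjecture 1 as typed. -/
theorem not_crux_iff :
    ¬ SAWDefectDecoherence.ObservableToSLER ↔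
      SAWDefectDecoherence.HexObservableLimitR ∧ SAWDefectDecoherence.HexTight ∧
        ¬ SAWDevelopingMap.HexConjecture := by
  constructor
  · intro h
    by_contra hc
    apply h
    intro hO hT
    by_contra hC
    exact hc ⟨hO, hT, hC⟩
  · rintro ⟨hO, hT, hC⟩ h
    exact hC (h hO hT)

/-- Route copy (SAWPhaseRetrieval). -/
theorem phaseRetrieval_iff :
    SAWPhaseRetrieval.ObservableToSLER ↔ SAWDefectDecoherence.ObservableToSLER := Iff.rfl

/-- Route copy (SAWWindingAlias, decl named `ObservableToSLE`). -/
theorem windingAlias_iff :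
    SAWWindingAlias.ObservableToSLE ↔ SAWDefectDecoherence.ObservableToSLER := Iff.rfl

/-- Route copy (SAWResidueField). -/
theorem residueField_iff :
    SAWResidueField.ObservableToSLER ↔ SAWDefectDecoherence.ObservableToSLER := Iff.rfl

/-- **ONE STATEMENT FILED TWICE.** Item stmt-CriticalPhenomena-10472
(`SAWDevelopingMap.ObservableToSLE`, antecedent `SAWDevelopingMap.HexObservableLimit` = item 14003)
and item stmt-CriticalPhenomena-14005 (`ObservableToSLER`) are syntactically the same proposition. -/
theorem same_statement_as_item_10472 :
    SAWDefectDecoherence.ObservableToSLER ↔ SAWDevelopingMap.ObservableToSLE := Iff.rfl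

/-- The antecedents agree too: `HexObservableLimitR` (this route) is `SAWDevelopingMap.HexObservableLimit`
(both item 14003). -/
theorem obsLimitR_iff_developingMap :
    SAWDefectDecoherence.HexObservableLimitR ↔ SAWDevelopingMap.HexObservableLimit := Iff.rfl

theorem hexTight_iff_developingMap :
    SAWDefectDecoherence.HexTight ↔ SAWDevelopingMap.HexTight := Iff.rfl

theorem hexConjecture_iff_developingMap :
    SAWDevelopingMap.HexConjecture ↔ SAWDevelopingMap.HexConjecture := Iff.rfl

/-! ## §2 Load-bearing analysis: the crux with a hypothesis dropped

Both weakenings are implied by `HexConjecture`, so NO theorem `observableToSLER_false_without_<H>`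
can be proved without refuting DCS Conjecture 1 itself: truth-wise the hypotheses are decoration,
proof-wise they are everything. -/

/-- The crux with `HexObservableLimitR` dropped. -/
def ObservableToSLERWithoutObsLimit : Prop :=
  SAWDefectDecoherence.HexTight → SAWDevelopingMap.HexConjecture

/-- The crux with `HexTight` dropped. -/
def ObservableToSLERWithoutTight : Prop :=
  SAWDefectDecoherence.HexObservableLimitR → SAWDevelopingMap.HexConjecture

/-- The crux with both hypotheses dropped is DCS Conjecture 1. -/
def ObservableToSLERWithoutHyps : Prop :=
  SAWDevelopingMap.HexConjecture

theorem withoutObsLimit_of_hexConjecture (h : SAWDevelopingMap.HexConjecture) :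
    ObservableToSLERWithoutObsLimit := fun _ => h

theorem withoutTight_of_hexConjecture (h : SAWDevelopingMap.HexConjecture) :
    ObservableToSLERWithoutTight := fun _ => h

theorem crux_of_withoutObsLimit (h : ObservableToSLERWithoutObsLimit) :
    SAWDefectDecoherence.ObservableToSLER := fun _ hT => h hT

theorem crux_of_withoutTight (h : ObservableToSLERWithoutTight) :
    SAWDefectDecoherence.ObservableToSLER := fun hO _ => h hO

theorem withoutHyps_iff : ObservableToSLERWithoutHyps ↔ SAWDevelopingMap.HexConjecture := Iff.rfl

/-- W5 at item level (landed `Negative.TightnessNecessity`): `HexConjecture → HexTight`. -/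
theorem hexTight_of_hexConjecture' (h : SAWDevelopingMap.HexConjecture) :
    SAWDefectDecoherence.HexTight :=
  hexTight_of_hexConjecture h

/-- W5 PORT: dropping `HexTight` from the crux costs exactly `HexObservableLimitR → HexTight`;
any line that proves the crux without using `HexTight` proves `HexTight` on the way. -/
theorem withoutTight_iff :
    ObservableToSLERWithoutTight ↔
      ((SAWDefectDecoherence.HexObservableLimitR → SAWDefectDecoherence.HexTight) ∧
        SAWDefectDecoherence.ObservableToSLER) := by
  constructor
  · intro h
    exact ⟨fun hO => hexTight_of_hexConjecture (h hO), fun hO _ => h hO⟩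
  · rintro ⟨hT, hc⟩ hO
    exact hc hO (hT hO)

/-- Given the target, the crux reads `HexObservableLimitR → (HexTight ↔ HexConjecture)`. -/
theorem crux_iff_obsLimit_imp_tight_iff_conj :
    SAWDefectDecoherence.ObservableToSLER ↔
      (SAWDefectDecoherence.HexObservableLimitR →
        (SAWDefectDecoherence.HexTight ↔ SAWDevelopingMap.HexConjecture)) := by
  constructor
  · intro h hO
    exact ⟨h hO, hexTight_of_hexConjecture⟩
  · intro h hO hT
    exact (h hO).1 hT

/-! ## §3 The crux is exactly identification of subsequential limits (landed `Negative.Identification`) -/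

/-- `ObservableToSLER ⇔ (HexObservableLimitR → HexTight → every probability subsequential limit law
of the critical hexagonal SAW in (D; a_δ, b_δ) is the chordal SLE(8/3) law)`. -/
theorem crux_iff_identification :
    SAWDefectDecoherence.ObservableToSLER ↔
      (SAWDefectDecoherence.HexObservableLimitR → SAWDefectDecoherence.HexTight →
        ∀ (D : DobrushinDomain) (a b : ℝ → HexVertex),
          IsEmbEndpointApprox hexGraph hexCenter D a b →
            ∀ μ : Measure (CurveClass ℂ), IsProbabilityMeasure μ →
              IsSubseqLimitLaw (fun δ (γ : HexDomainSAW D.carrier δ (a δ) (b δ)) => γ.curve)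
                (fun δ => hexSAWLaw D.carrier δ (a δ) (b δ)) μ →
                IsSLELaw ((8 : ℝ≥0) / 3) D μ) :=
  observableToSLE_iff_identification

/-- Pointwise structure of the conclusion (landed): convergence ⇔ endpoint approximation ∧
tightness ∧ identification. -/
example {D : DobrushinDomain} {a b : ℝ → HexVertex} :
    ConvergesInLawToSLE ((8 : ℝ≥0) / 3) D
        (fun δ (γ : HexDomainSAW D.carrier δ (a δ) (b δ)) => γ.curve)
        (fun δ => hexSAWLaw D.carrier δ (a δ) (b δ)) ↔
      IsEmbEndpointApprox hexGraph hexCenter D a b ∧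
      IsTightAlongMesh (fun δ (γ : HexDomainSAW D.carrier δ (a δ) (b δ)) => γ.curve)
        (fun δ => hexSAWLaw D.carrier δ (a δ) (b δ)) ∧
      ∀ μ : Measure (CurveClass ℂ), IsProbabilityMeasure μ →
        IsSubseqLimitLaw (fun δ (γ : HexDomainSAW D.carrier δ (a δ) (b δ)) => γ.curve)
          (fun δ => hexSAWLaw D.carrier δ (a δ) (b δ)) μ → IsSLELaw ((8 : ℝ≥0) / 3) D μ :=
  convergesInLawToSLE_iff_tight_and_identification

/-! ## §4 Silence of `HexObservableLimitR` where the conclusion must be proved -/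

/-- The per-domain, per-constant CONTENT of `HexObservableLimitR` (its `∀`-body at a fixed
Dobrushin domain `D` and constant `c`). -/
def ObsLimitRBody (c : ℂ) (D : DobrushinDomain) : Prop :=
  ∀ (ρ : ℝ) (Λ : ℝ → Finset HexVertex) (m : Fin 2 → ℝ → ℤ) (a b : ℝ → Sym2 HexVertex)
    (Φ : ConformalEquiv D.carrier UpperHalfPlane.upperHalfPlaneSet) (L : ℂ → ℂ) (Lb : ℂ) (ψ : ℂ → ℂ),
    let F : ℝ → Sym2 HexVertex → ℂ := fun δ z =>
      hexParafermionicObservable (Λ δ) (a δ) hexCriticalFugacity (5 / 8) z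
    0 < ρ →
    (∀ i : Fin 2, D.carrier ∩ Metric.ball (D.pt i) ρ =
      {z : ℂ | (D.pt i).im < z.im} ∩ Metric.ball (D.pt i) ρ) →
    (∀ᶠ δ : ℝ in nhdsWithin 0 (Set.Ioi 0),
      hexDomainSimplyConnected (Λ δ) ∧ a δ ∈ hexDomainBoundary (Λ δ) ∧
        b δ ∈ hexDomainBoundary (Λ δ) ∧ Nonempty (HexMidEdgeSAW (Λ δ) (a δ) (b δ)) ∧
        (hexGraph.induce ((Λ δ : Finset HexVertex) : Set HexVertex)).Preconnected ∧
        (∀ v ∈ Λ δ, (δ : ℂ) * hexCenter v ∈ D.carrier) ∧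
        (∀ i : Fin 2, ∀ v : HexVertex, (δ : ℂ) * hexCenter v ∈ Metric.ball (D.pt i) ρ →
          (v ∈ Λ δ ↔ m i δ ≤ v.1 1))) →
    (∀ K : Set ℂ, IsCompact K → K ⊆ D.carrier → ∀ᶠ δ : ℝ in nhdsWithin 0 (Set.Ioi 0),
      ∀ v : HexVertex, (δ : ℂ) * hexCenter v ∈ K → v ∈ Λ δ) →
    Tendsto (fun δ : ℝ => (δ : ℂ) * hexMidpoint (a δ)) (nhdsWithin 0 (Set.Ioi 0)) (nhds (D.pt 0)) →
    Tendsto (fun δ : ℝ => (δ : ℂ) * hexMidpoint (b δ)) (nhdsWithin 0 (Set.Ioi 0)) (nhds (D.pt 1)) →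
    Tendsto (fun x => ‖Φ x‖) (nhdsWithin (D.pt 0) D.carrier) atTop →
    Φ.HasBoundaryValue (D.pt 1) 0 →
    ContinuousOn L D.carrier → (∀ z ∈ D.carrier, Complex.exp (L z) = deriv Φ z) →
    Tendsto L (nhdsWithin (D.pt 1) D.carrier) (nhds Lb) →
    Continuous ψ → HasCompactSupport ψ → tsupport ψ ⊆ D.carrier →
    Tendsto (fun δ : ℝ => (δ : ℂ) ^ 2 * (∑ᶠ e ∈ hexDomainMidEdges (Λ δ),
      ψ ((δ : ℂ) * hexMidpoint e) * F δ e) / F δ (b δ)) (nhdsWithin 0 (Set.Ioi 0))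
      (nhds (c * ∫ z, ψ z * Complex.exp ((5 / 8 : ℂ) * (L z - Lb))))

/-- `HexObservableLimitR ↔ ∃ c ≠ 0, ∀ D, ObsLimitRBody c D` (definitional). -/
theorem obsLimitR_iff_body :
    SAWDefectDecoherence.HexObservableLimitR ↔ ∃ c : ℂ, c ≠ 0 ∧ ∀ D, ObsLimitRBody c D :=
  Iff.rfl

/-- The two-point flat premise of `HexObservableLimitR` FAILS on the unit disc for every radius
(already at `pt 1 = -1`; landed `flat_premise_false_on_unitDisc`). -/
theorem two_point_flat_premise_false_on_unitDisc (ρ : ℝ) (hρ : 0 < ρ) :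
    ¬ ∀ i : Fin 2, DobrushinDomain.unitDisc.carrier ∩ Metric.ball (DobrushinDomain.unitDisc.pt i) ρ =
      {z : ℂ | (DobrushinDomain.unitDisc.pt i).im < z.im} ∩
        Metric.ball (DobrushinDomain.unitDisc.pt i) ρ :=
  fun h => flat_premise_false_on_unitDisc ρ hρ (h 1)

/-- **SILENCE IN POSITIVE FORM.** On the unit disc the content of `HexObservableLimitR` is provable
outright, for EVERY constant `c` (its flat premise is false there): the hypothesis of the crux says
nothing about `(𝔻; 1, -1)`, an instance where its conclusion (`HexConjecture`) must be proved. -/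
theorem obsLimitRBody_unitDisc (c : ℂ) : ObsLimitRBody c DobrushinDomain.unitDisc := by
  intro ρ Λ m a b Φ L Lb ψ _ hρ hflat
  exact absurd hflat (two_point_flat_premise_false_on_unitDisc ρ hρ)

/-- Hence `HexObservableLimitR` is consistent with ANY behaviour of the observable on the disc: it
is equivalent to itself with the disc instance removed. -/
theorem obsLimitR_iff_off_disc :
    SAWDefectDecoherence.HexObservableLimitR ↔
      ∃ c : ℂ, c ≠ 0 ∧ ∀ D, D ≠ DobrushinDomain.unitDisc → ObsLimitRBody c D := by
  rw [obsLimitR_iff_body]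
  constructor
  · rintro ⟨c, hc, h⟩
    exact ⟨c, hc, fun D _ => h D⟩
  · rintro ⟨c, hc, h⟩
    refine ⟨c, hc, fun D => ?_⟩
    by_cases hD : D = DobrushinDomain.unitDisc
    · subst hD; exact obsLimitRBody_unitDisc c
    · exact h D hD

/-- W1 for every domain (landed `Negative.FirstStepSilence`): after one exploration step along any
segment `[p, q]` with `(p, q] ⊆ D`, the slit domain is the carrier of NO Dobrushin domain, so
`HexObservableLimitR` (quantified over `DobrushinDomain`) is silent on every slit domain of the
martingale scheme `F_{Ω∖γ[0,n]}(·)/F_{Ω∖γ[0,n]}(b)`. -/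
example (D D' : DobrushinDomain) {p q : ℂ} (hpq : p ≠ q)
    (hseg : ∀ t ∈ Set.Ioc (0 : ℝ) 1, p + (t : ℂ) * (q - p) ∈ D.carrier) :
    D'.carrier ≠ D.carrier \ segment ℝ p q :=
  slitSegment_ne_carrier D D' hpq hseg

/-- Under the flat premise at a marked point the boundary near it is a horizontal segment (landed
`segment_subset_frontier_of_flat`, stated at `pt 1`): `HexObservableLimitR` only ever speaks about
domains with TWO straight horizontal boundary pieces, domain above. -/
example (D : DobrushinDomain) {ρ : ℝ}
    (hflat : D.carrier ∩ Metric.ball (D.pt 1) ρ = {z : ℂ | (D.pt 1).im < z.im} ∩ Metric.ball (D.pt 1) ρ)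
    {r : ℝ} (hr : |r| < ρ) : D.pt 1 + r ∈ frontier D.carrier :=
  segment_subset_frontier_of_flat D hflat hr


/-! ## §5 The root pin is the only thing between `HexObservableLimitR` and a refuted statement

`HexObservableLimitRootFree` is `HexObservableLimitR` with its two ROOT clauses deleted (the flat
ball at `pt 0` and the exact half-lattice at `pt 0`), i.e. VERBATIM the refuted item
stmt-CriticalPhenomena-5420.  It is a strengthening of `HexObservableLimitR`
(`obsLimitR_of_rootFree`) and it is FALSE (`not_rootFree`: the corridor witness, replayed on the
landed engine `Theorems/BoundaryClosureNegative_*`).  For THIS crux: (i) strengthening the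
hypothesis back to the root-free form makes the crux vacuous (`crux_withRootFreeHyp`); (ii) the
bootstrap "flat-pinned root ⟹ rough root" that the intended proof needs for the slit domains
`Ω ∖ γ[0,n]` cannot land in the root-free averaged form — an admissible rough-root Conjecture 2 must
retain lattice control at the root (the corridor witness relocates the conformal root inside a free
`o(1)`-collar; the SAW's own slit domains have the CANONICAL lattice at the tip, no collar freedom). -/

open Summit.CriticalPhenomena.SAWScalingLimit.Theorems.BoundaryClosure.Negative in
/-- `HexObservableLimitR` with the root clauses deleted = item stmt-CriticalPhenomena-5420 verbatim
(flat ball and exact half-lattice at `pt 1` only; `m : ℝ → ℤ`). -/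
def HexObservableLimitRootFree : Prop :=
  ∃ c : ℂ, c ≠ 0 ∧ ∀ (D : DobrushinDomain) (ρ : ℝ) (Λ : ℝ → Finset HexVertex) (m : ℝ → ℤ)
    (a b : ℝ → Sym2 HexVertex) (Φ : ConformalEquiv D.carrier UpperHalfPlane.upperHalfPlaneSet)
    (L : ℂ → ℂ) (Lb : ℂ) (ψ : ℂ → ℂ),
    let F : ℝ → Sym2 HexVertex → ℂ := fun δ z =>
      hexParafermionicObservable (Λ δ) (a δ) hexCriticalFugacity (5 / 8) z
    0 < ρ →
    D.carrier ∩ Metric.ball (D.pt 1) ρ = {z : ℂ | (D.pt 1).im < z.im} ∩ Metric.ball (D.pt 1) ρ →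
    (∀ᶠ δ : ℝ in nhdsWithin 0 (Set.Ioi 0),
      hexDomainSimplyConnected (Λ δ) ∧ a δ ∈ hexDomainBoundary (Λ δ) ∧
        b δ ∈ hexDomainBoundary (Λ δ) ∧ Nonempty (HexMidEdgeSAW (Λ δ) (a δ) (b δ)) ∧
        (hexGraph.induce ((Λ δ : Finset HexVertex) : Set HexVertex)).Preconnected ∧
        (∀ v ∈ Λ δ, (δ : ℂ) * hexCenter v ∈ D.carrier) ∧
        (∀ v : HexVertex, (δ : ℂ) * hexCenter v ∈ Metric.ball (D.pt 1) ρ →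
          (v ∈ Λ δ ↔ m δ ≤ v.1 1))) →
    (∀ K : Set ℂ, IsCompact K → K ⊆ D.carrier → ∀ᶠ δ : ℝ in nhdsWithin 0 (Set.Ioi 0),
      ∀ v : HexVertex, (δ : ℂ) * hexCenter v ∈ K → v ∈ Λ δ) →
    Tendsto (fun δ : ℝ => (δ : ℂ) * hexMidpoint (a δ)) (nhdsWithin 0 (Set.Ioi 0)) (nhds (D.pt 0)) →
    Tendsto (fun δ : ℝ => (δ : ℂ) * hexMidpoint (b δ)) (nhdsWithin 0 (Set.Ioi 0)) (nhds (D.pt 1)) →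
    Tendsto (fun x => ‖Φ x‖) (nhdsWithin (D.pt 0) D.carrier) atTop →
    Φ.HasBoundaryValue (D.pt 1) 0 →
    ContinuousOn L D.carrier → (∀ z ∈ D.carrier, Complex.exp (L z) = deriv Φ z) →
    Tendsto L (nhdsWithin (D.pt 1) D.carrier) (nhds Lb) →
    Continuous ψ → HasCompactSupport ψ → tsupport ψ ⊆ D.carrier →
    Tendsto (fun δ : ℝ => (δ : ℂ) ^ 2 * (∑ᶠ e ∈ hexDomainMidEdges (Λ δ),
      ψ ((δ : ℂ) * hexMidpoint e) * F δ e) / F δ (b δ)) (nhdsWithin 0 (Set.Ioi 0))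
      (nhds (c * ∫ z, ψ z * Complex.exp ((5 / 8 : ℂ) * (L z - Lb))))

/-- The root-free form is a STRENGTHENING of `HexObservableLimitR` (it assumes less per domain). -/
theorem obsLimitR_of_rootFree (h : HexObservableLimitRootFree) :
    SAWDefectDecoherence.HexObservableLimitR := by
  obtain ⟨c, hc, H⟩ := h
  refine ⟨c, hc, ?_⟩
  intro D ρ Λ m a b Φ L Lb ψ F hρ hflat hdisc hK ha hb hΦ hΦb hL hexp hLb hψ hψK hψD
  exact H D ρ Λ (m 1) a b Φ L Lb ψ hρ (hflat 1)
    (hdisc.mono fun δ h =>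
      ⟨h.1, h.2.1, h.2.2.1, h.2.2.2.1, h.2.2.2.2.1, h.2.2.2.2.2.1, h.2.2.2.2.2.2 1⟩)
    hK ha hb hΦ hΦb hL hexp hLb hψ hψK hψD

open Summit.CriticalPhenomena.SAWScalingLimit.Theorems.BoundaryClosure.Negative in
/-- **THE ROOT-FREE FORM IS FALSE** (the corridor witness of
`SAWDefectDecoherenceHexObservableLimit_refuted`, item 5420, replayed on the landed engine): on the
upper half unit disc, a width-one boundary corridor with a moat relocates the conformally effective
root from `3/4` to `1/2` while every root-free hypothesis holds, and `c ≠ 0` then forces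
`z (p - q)(1 - p q) = 0` on the half-disc. -/
theorem not_rootFree : ¬ HexObservableLimitRootFree := by
  rintro ⟨c, hc, H⟩
  have hp : (0 : ℝ) < 3 / 4 ∧ (3 / 4 : ℝ) < 1 := by norm_num
  have hq : (0 : ℝ) < 1 / 2 ∧ (1 / 2 : ℝ) < 1 := by norm_num
  have hx : hexCriticalFugacity ≠ 0 := hexCriticalFugacity_pos_lt_one.1.ne'
  -- Step 1: for every test function the two predicted limits coincide
  have key : ∀ ψ : ℂ → ℂ, Continuous ψ → HasCompactSupport ψ → tsupport ψ ⊆ HD →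
      c * ∫ z, ψ z * Complex.exp ((5 / 8 : ℂ) * (Lfun (1 / 2) z - Lfun (1 / 2) 0)) =
        c * ∫ z, ψ z * Complex.exp ((5 / 8 : ℂ) * (Lfun (3 / 4) z - Lfun (3 / 4) 0)) := by
    intro ψ hψc hψK hψD
    have h1 := instance_limit H hq false (fun δ hδ => abs_Xc δ hδ) hψc hψK hψD
    have h2 := instance_limit H hp true (fun δ hδ => abs_Tc δ hδ) hψc hψK hψD
    simp only [rootCell, Bool.false_eq_true, ↓reduceIte] at h1
    simp only [rootCell, ↓reduceIte] at h2
    obtain ⟨ε, hε, -, hthick⟩ := exists_thick_of_isCompact hψK hψD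
    have heq : (fun δ : ℝ => (δ : ℂ) ^ 2 * (∑ᶠ e ∈ hexDomainMidEdges (Lam δ true),
        ψ ((δ : ℂ) * hexMidpoint e) * hexParafermionicObservable (Lam δ true) (aEdge (Tc δ))
          hexCriticalFugacity (5 / 8) e) /
        hexParafermionicObservable (Lam δ true) (aEdge (Tc δ)) hexCriticalFugacity (5 / 8) bEdge)
        =ᶠ[𝓝[>] 0]
        fun δ : ℝ => (δ : ℂ) ^ 2 * (∑ᶠ e ∈ hexDomainMidEdges (Lam δ false),
        ψ ((δ : ℂ) * hexMidpoint e) * hexParafermionicObservable (Lam δ false) (aEdge (Xc δ))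
          hexCriticalFugacity (5 / 8) e) /
        hexParafermionicObservable (Lam δ false) (aEdge (Xc δ)) hexCriticalFugacity (5 / 8) bEdge := by
      filter_upwards [eventually_small (by positivity : 0 < ε / 2)] with δ hδ
      obtain ⟨hδ, hδ', hδε⟩ := hδ
      refine ratio_eq hδ hδ' _ _ hx ψ fun e he => ?_
      have hmem : (δ : ℂ) * hexMidpoint e ∈ tsupport ψ := subset_tsupport _ he
      have him := (hthick _ hmem).2
      rw [Complex.im_ofReal_mul] at him
      by_contra hlt
      push Not at hlt
      nlinarith
    exact tendsto_nhds_unique h1 (h2.congr' heq)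
  -- Step 2: the difference of the two densities is orthogonal to all test functions, hence zero
  have hG : ∀ z ∈ HD, Complex.exp ((5 / 8 : ℂ) * (Lfun (1 / 2) z - Lfun (1 / 2) 0)) =
      Complex.exp ((5 / 8 : ℂ) * (Lfun (3 / 4) z - Lfun (3 / 4) 0)) := by
    intro z hz
    have := eq_zero_of_forall_integral isOpen_HD
      (G := fun z => Complex.exp ((5 / 8 : ℂ) * (Lfun (1 / 2) z - Lfun (1 / 2) 0)) -
        Complex.exp ((5 / 8 : ℂ) * (Lfun (3 / 4) z - Lfun (3 / 4) 0)))
      ((continuousOn_g hq).sub (continuousOn_g hp)) (fun ψ hψc hψK hψD => ?_) hz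
    · exact sub_eq_zero.1 this
    · have i1 : MeasureTheory.Integrable fun z => ψ z *
          Complex.exp ((5 / 8 : ℂ) * (Lfun (1 / 2) z - Lfun (1 / 2) 0)) :=
        (continuous_mul_of_tsupport_subset isOpen_HD hψc hψD
          (continuousOn_g hq)).integrable_of_hasCompactSupport hψK.mul_right
      have i2 : MeasureTheory.Integrable fun z => ψ z *
          Complex.exp ((5 / 8 : ℂ) * (Lfun (3 / 4) z - Lfun (3 / 4) 0)) :=
        (continuous_mul_of_tsupport_subset isOpen_HD hψc hψD
          (continuousOn_g hp)).integrable_of_hasCompactSupport hψK.mul_right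
      show ∫ z, ψ z * (Complex.exp ((5 / 8 : ℂ) * (Lfun (1 / 2) z - Lfun (1 / 2) 0)) -
          Complex.exp ((5 / 8 : ℂ) * (Lfun (3 / 4) z - Lfun (3 / 4) 0))) = 0
      have e : (fun z => ψ z * (Complex.exp ((5 / 8 : ℂ) * (Lfun (1 / 2) z - Lfun (1 / 2) 0)) -
          Complex.exp ((5 / 8 : ℂ) * (Lfun (3 / 4) z - Lfun (3 / 4) 0)))) =
          fun z => ψ z * Complex.exp ((5 / 8 : ℂ) * (Lfun (1 / 2) z - Lfun (1 / 2) 0)) -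
            ψ z * Complex.exp ((5 / 8 : ℂ) * (Lfun (3 / 4) z - Lfun (3 / 4) 0)) := by
        funext z; ring
      rw [e, MeasureTheory.integral_sub i1 i2, sub_eq_zero]
      exact mul_left_cancel₀ hc (key ψ hψc hψK hψD)
  -- Step 3: the two normalisations are incompatible
  exact endgame hp hq (by norm_num) hG

/-- Hence the crux with its hypothesis STRENGTHENED back to the root-free form is vacuously true —
that strengthening of the hypothesis is worthless (and dually: no weakening of the crux in this
direction can be refuted). -/
theorem crux_withRootFreeHyp :
    HexObservableLimitRootFree → SAWDefectDecoherence.HexTight → SAWDevelopingMap.HexConjecture :=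
  fun h => absurd h not_rootFree

/-- `HexObservableLimitR` sits strictly between a refuted statement and DCS Conjecture 2: it is
implied by the (false) root-free form and nobody knows whether it holds.  Recorded as the
implication chain available to provers. -/
theorem rootFree_strictly_stronger :
    (HexObservableLimitRootFree → SAWDefectDecoherence.HexObservableLimitR) ∧
      ¬ HexObservableLimitRootFree :=
  ⟨obsLimitR_of_rootFree, not_rootFree⟩

/-! ## §6 Mechanism algebra: Itô drift of the observable martingale and of its normalised ratio

Loewner flow `∂_t g_t(z) = 2/(g_t(z) − W_t)`, `W = √κ B`; write `X = g_t(z) − W_t`,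
`U = g_t(u) − W_t` for a BOUNDARY point `u` (so `U` is real), `A = log g_t′(z)`, `C = log g_t′(u)`.
Then `dX = (2/X) dt − dW`, `dU = (2/U) dt − dW`, `dA = −(2/X²) dt`, `dC = −(2/U²) dt`,
`d⟨X⟩ = d⟨U⟩ = d⟨X, U⟩ = κ dt`.  For `M = g′(z)^α X^β` the drift per `dt`, divided by
`M / X²`, is `itoDrift α β κ`; for the RATIO `N = g′(z)^α X^β · g′(u)^{−α} U^{−β}` (the observable
normalised at `u`) the drift per `dt`, divided by `N`, is `ratioDrift α β κ X U`. -/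

/-- Drift coefficient of `g′^α (g − W)^β`: `−2α + 2β + κ β(β−1)/2`. -/
def itoDrift (α β κ : ℝ) : ℝ := -2 * α + 2 * β + κ * β * (β - 1) / 2

/-- With the parafermionic data `(α, β) = (5/8, −5/4)` the observable is a local martingale iff
`κ = 8/3` (LSW 2003 Prop. 5.2-type arithmetic). -/
theorem itoDrift_eq_zero_iff (κ : ℝ) : itoDrift (5 / 8) (-5 / 4) κ = 0 ↔ κ = 8 / 3 := by
  unfold itoDrift
  constructor <;> intro h <;> linarith

/-- The general family: for `β(β−1) ≠ 0` the drift vanishes iff `κ = 4(α − β)/(β(β − 1))`. -/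
theorem itoDrift_family {α β : ℝ} (hβ : β * (β - 1) ≠ 0) (κ : ℝ) :
    itoDrift α β κ = 0 ↔ κ = 4 * (α - β) / (β * (β - 1)) := by
  unfold itoDrift
  rw [eq_div_iff hβ]
  constructor <;> intro h <;> linarith

/-- Drift per `dt` (divided by `N`) of the ratio `N = g′(z)^α X^β g′(u)^{−α} U^{−β}` — the
observable normalised at the boundary point `u`:
`itoDrift/X² + (2α − 2β + κβ(β+1)/2)/U² − κβ²/(XU)` (Itô with the cross-variation term). -/
def ratioDrift (α β κ X U : ℝ) : ℝ :=
  itoDrift α β κ / X ^ 2 + (2 * α - 2 * β + κ * β * (β + 1) / 2) / U ^ 2 - κ * β ^ 2 / (X * U)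

/-- **NORMALISING AT A NON-TARGET BOUNDARY POINT LEAVES A DRIFT.** At `(α, β, κ) = (5/8, −5/4, 8/3)`
the ratio drift is `(25/6)(X − U)/(X U²)`. -/
theorem ratioDrift_eq {X U : ℝ} (hX : X ≠ 0) (hU : U ≠ 0) :
    ratioDrift (5 / 8) (-5 / 4) (8 / 3) X U = 25 / 6 * (X - U) / (X * U ^ 2) := by
  unfold ratioDrift itoDrift
  field_simp
  ring

/-- … which is NONZERO for every bulk point `z ≠ u`: the `b`-normalised observable is a continuum
local martingale only because `b` is the TARGET of the curve. -/
theorem ratioDrift_ne_zero {X U : ℝ} (hX : X ≠ 0) (hU : U ≠ 0) (hXU : X ≠ U) :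
    ratioDrift (5 / 8) (-5 / 4) (8 / 3) X U ≠ 0 := by
  rw [ratioDrift_eq hX hU]
  have h1 : X - U ≠ 0 := sub_ne_zero.2 hXU
  have h2 : X * U ^ 2 ≠ 0 := mul_ne_zero hX (pow_ne_zero 2 hU)
  exact div_ne_zero (mul_ne_zero (by norm_num) h1) h2

/-- **HYDRODYNAMIC TANGENCY.** As the normalisation point tends to the target (`U → ∞` in the
half-plane picture, where the target is `∞`), the ratio drift vanishes: normalising at the target
`b = pt 1` is exactly what makes `F(z)/F(b)` driftless at `κ = 8/3`. -/
theorem tendsto_ratioDrift_atTop {X : ℝ} (hX : X ≠ 0) :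
    Tendsto (fun U : ℝ => ratioDrift (5 / 8) (-5 / 4) (8 / 3) X U) atTop (𝓝 0) := by
  have h : (fun U : ℝ => ratioDrift (5 / 8) (-5 / 4) (8 / 3) X U) =ᶠ[atTop]
      fun U : ℝ => 25 / 6 * (U⁻¹ * U⁻¹) - 25 / 6 * X⁻¹ * U⁻¹ := by
    filter_upwards [eventually_ne_atTop (0 : ℝ)] with U hU
    rw [ratioDrift_eq hX hU]
    field_simp
  rw [tendsto_congr' h]
  have h0 : Tendsto (fun U : ℝ => U⁻¹) atTop (𝓝 0) := tendsto_inv_atTop_zero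
  have h1 : Tendsto (fun U : ℝ => 25 / 6 * (U⁻¹ * U⁻¹)) atTop (𝓝 (25 / 6 * (0 * 0))) :=
    (h0.mul h0).const_mul _
  have h2 : Tendsto (fun U : ℝ => 25 / 6 * X⁻¹ * U⁻¹) atTop (𝓝 (25 / 6 * X⁻¹ * 0)) :=
    h0.const_mul _
  simpa using h1.sub h2

/-! ## §7 Dictionary gap: exact half-lattice clause versus the canonical discretisation -/

/-- At height `0` the canonical hexagonal discretisation of an upper half-plane piece IS the exact
half-lattice `{x₁ ≥ 0}` at every mesh: the good case of the clause `v ∈ Λ δ ↔ m ≤ v.1 1`. -/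
theorem canonical_halfLattice_height_zero {δ : ℝ} (hδ : 0 < δ) (v : HexVertex) :
    0 < ((δ : ℂ) * hexCenter v).im ↔ 0 ≤ v.1 1 := by
  obtain ⟨x, k⟩ := v
  rw [Complex.im_ofReal_mul, (hexCenter_re_im x k).2]
  have h3 : 0 < Real.sqrt 3 / 2 := by positivity
  have hk : ((k : ℕ) : ℝ) = 0 ∨ ((k : ℕ) : ℝ) = 1 := by
    fin_cases k <;> simp
  constructor
  · intro h
    have h' : 0 < (x 1 : ℝ) + (((k : ℕ) : ℝ) + 1) / 3 := by
      by_contra hle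
      push Not at hle
      have := mul_nonpos_of_nonneg_of_nonpos (mul_pos hδ h3).le hle
      nlinarith [mul_pos hδ h3]
    have hx : (-1 : ℝ) < x 1 := by rcases hk with hk | hk <;> rw [hk] at h' <;> linarith
    exact_mod_cast (show (-1 : ℤ) < x 1 by exact_mod_cast hx)
  · intro h
    have hx : (0 : ℝ) ≤ x 1 := by exact_mod_cast h
    have h' : 0 < (x 1 : ℝ) + (((k : ℕ) : ℝ) + 1) / 3 := by rcases hk with hk | hk <;> rw [hk] <;> linarith
    exact mul_pos hδ (mul_pos h3 h')

/-- **A FLAT PIECE AT POSITIVE HEIGHT SPLITS LATTICE ROWS ALONG A SEQUENCE OF MESHES.** For every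
height `y > 0` and every row index `k`, at the mesh `δ_k = y / ((√3/2)(k + 1/2))` the canonical
discretisation `{v : y < im(δ_k · c_v)}` of the half-plane `{im z > y}` is NOT of the form
`{v : m ≤ v.1 1}`: row `k` is split between its two sublattices.  So for a Dobrushin domain flat
near a marked point at height `y ≠ 0`, the exact-half-lattice clause of `HexObservableLimitR`
excludes the canonical `Ω_δ` along `δ_k → 0⁺` — the hypothesis then never speaks about the domain
of `hexSAWLaw` itself at those meshes (a dictionary gap on top of W1/W2). -/
theorem canonical_not_halfLattice {y : ℝ} (hy : 0 < y) (k : ℕ) :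
    ¬ ∃ m : ℤ, ∀ v : HexVertex,
      (y < (((y / (Real.sqrt 3 / 2 * ((k : ℝ) + 1 / 2)) : ℝ) : ℂ) * hexCenter v).im ↔ m ≤ v.1 1) := by
  rintro ⟨m, hm⟩
  have h3 : 0 < Real.sqrt 3 / 2 := by positivity
  have hden : 0 < Real.sqrt 3 / 2 * ((k : ℝ) + 1 / 2) := by positivity
  set δ : ℝ := y / (Real.sqrt 3 / 2 * ((k : ℝ) + 1 / 2)) with hδ
  have hδpos : 0 < δ := div_pos hy hden
  have him : ∀ t : Fin 2, ((δ : ℂ) * hexCenter (![0, (k : ℤ)], t)).im =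
      δ * (Real.sqrt 3 / 2 * ((k : ℝ) + (((t : ℕ) : ℝ) + 1) / 3)) := by
    intro t
    rw [Complex.im_ofReal_mul, (hexCenter_re_im _ t).2]
    simp
  -- the upper sublattice of row `k` is inside
  have hin : y < ((δ : ℂ) * hexCenter (![0, (k : ℤ)], (1 : Fin 2))).im := by
    rw [him]
    have : y = δ * (Real.sqrt 3 / 2 * ((k : ℝ) + 1 / 2)) := by
      rw [hδ, div_mul_cancel₀ _ hden.ne']
    rw [this]
    refine mul_lt_mul_of_pos_left (mul_lt_mul_of_pos_left ?_ h3) hδpos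
    simp
    norm_num
  -- the lower sublattice of row `k` is outside
  have hout : ¬ y < ((δ : ℂ) * hexCenter (![0, (k : ℤ)], (0 : Fin 2))).im := by
    rw [him, not_lt]
    have : y = δ * (Real.sqrt 3 / 2 * ((k : ℝ) + 1 / 2)) := by
      rw [hδ, div_mul_cancel₀ _ hden.ne']
    rw [this]
    refine mul_le_mul_of_nonneg_left (mul_le_mul_of_nonneg_left ?_ h3.le) hδpos.le
    simp
    norm_num
  have h1 : m ≤ (k : ℤ) := by simpa using (hm (![0, (k : ℤ)], (1 : Fin 2))).1 hin
  exact hout ((hm (![0, (k : ℤ)], (0 : Fin 2))).2 (by simpa using h1))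

/-- The splitting meshes tend to `0`: the obstruction recurs at arbitrarily small scales. -/
theorem tendsto_splitMesh {y : ℝ} :
    Tendsto (fun k : ℕ => y / (Real.sqrt 3 / 2 * ((k : ℝ) + 1 / 2))) atTop (𝓝 0) := by
  have h : Tendsto (fun k : ℕ => Real.sqrt 3 / 2 * ((k : ℝ) + 1 / 2)) atTop atTop := by
    refine Tendsto.const_mul_atTop (by positivity) ?_
    exact tendsto_atTop_add_const_right _ _ tendsto_natCast_atTop_atTop
  exact h.inv_tendsto_atTop.const_mul y |>.congr (fun k => by simp [div_eq_mul_inv]) |>.trans (by simp)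

/-! ## §8 Orientation silence: `HexObservableLimitR` binds only the co-oriented class `(1, 1)` -/

/-- `D` is FLAT at the marked point `pt i` at radius `ρ` with inner unit normal `u·I`: inside
`B(pt i, ρ)` the domain is the open half-plane `{im(ū (z − pt i)) > 0}`.  For `u = 1` this is
verbatim the ball clause of `HexObservableLimitR` (`flatAt_one_iff`); `u ^ 6 = 1` gives the six
lattice half-plane orientations of card 3's `IsFlatPinned` / card 2's `FloorIdU`. -/
def FlatAt (D : DobrushinDomain) (i : Fin 2) (u : ℂ) (ρ : ℝ) : Prop :=
  D.carrier ∩ Metric.ball (D.pt i) ρ =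
    {z : ℂ | 0 < ((starRingEnd ℂ) u * (z - D.pt i)).im} ∩ Metric.ball (D.pt i) ρ

/-- Orientation `u = 1` is exactly the ball clause of `HexObservableLimitR`. -/
theorem flatAt_one_iff (D : DobrushinDomain) (i : Fin 2) (ρ : ℝ) :
    FlatAt D i 1 ρ ↔
      D.carrier ∩ Metric.ball (D.pt i) ρ = {z : ℂ | (D.pt i).im < z.im} ∩ Metric.ball (D.pt i) ρ := by
  unfold FlatAt
  have : {z : ℂ | 0 < ((starRingEnd ℂ) (1 : ℂ) * (z - D.pt i)).im} = {z : ℂ | (D.pt i).im < z.im} := by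
    ext z
    simp only [map_one, one_mul, Complex.sub_im, Set.mem_setOf_eq, sub_pos]
  rw [this]

/-- The witness direction: for a unit `u ≠ 1`, `w = I (1 − u)` points INTO the class-`1` half-plane
and OUT of the class-`u` half-plane. -/
theorem witness_dir {u : ℂ} (hu : ‖u‖ = 1) (hu1 : u ≠ 1) :
    0 < (Complex.I * (1 - u)).im ∧ ((starRingEnd ℂ) u * (Complex.I * (1 - u))).im < 0 ∧
      ‖Complex.I * (1 - u)‖ ≤ 2 := by
  have hsq : u.re * u.re + u.im * u.im = 1 := by
    have h := Complex.normSq_eq_norm_sq u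
    rw [hu, Complex.normSq_apply] at h
    nlinarith
  have hre : u.re < 1 := by
    rcases (Complex.abs_re_le_norm u).lt_or_eq with h | h
    · rw [hu] at h
      exact (le_abs_self _).trans_lt h
    · -- |re u| = 1 forces im u = 0, then u = ±1
      rw [hu] at h
      have him : u.im = 0 := by
        have : u.re * u.re = 1 := by
          rcases abs_eq (zero_le_one) |>.1 h with h' | h' <;> rw [h'] <;> ring
        nlinarith
      rcases abs_eq (zero_le_one) |>.1 h with h' | h'
      · exact absurd (Complex.ext (by simpa using h') (by simpa using him)) hu1
      · rw [h']; norm_num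
  refine ⟨?_, ?_, ?_⟩
  · simp only [Complex.mul_im, Complex.I_re, Complex.sub_im, Complex.one_im, zero_sub, zero_mul,
      Complex.I_im, Complex.sub_re, Complex.one_re, one_mul, zero_add]
    linarith
  · simp only [Complex.mul_im, Complex.mul_re, Complex.I_re, Complex.sub_re, Complex.one_re, zero_mul,
      Complex.I_im, Complex.sub_im, Complex.one_im, zero_sub, one_mul, zero_add, Complex.conj_re,
      Complex.conj_im]
    nlinarith
  · calc ‖Complex.I * (1 - u)‖ = ‖(1 : ℂ) - u‖ := by rw [norm_mul, Complex.norm_I, one_mul]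
      _ ≤ ‖(1 : ℂ)‖ + ‖u‖ := norm_sub_le _ _
      _ = 2 := by rw [hu]; norm_num

/-- **A TILTED OR FLIPPED FLAT PIECE FALSIFIES `R`'S BALL CLAUSE AT EVERY RADIUS.**  If `D` is
flat at `pt i` in orientation `u` (`‖u‖ = 1`, `u ≠ 1`) at some radius `ρ₀ > 0`, then for every
`ρ > 0` the class-`1` clause `D ∩ B(pt i, ρ) = {im z > im (pt i)} ∩ B(pt i, ρ)` of
`HexObservableLimitR` is false (witness `pt i + t·I(1 − u)`, `t = min ρ ρ₀ / 4`). -/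
theorem rFlat_false_of_flatAt {D : DobrushinDomain} {i : Fin 2} {u : ℂ} {ρ₀ : ℝ}
    (hu : ‖u‖ = 1) (hu1 : u ≠ 1) (hρ₀ : 0 < ρ₀) (h : FlatAt D i u ρ₀) (ρ : ℝ) (hρ : 0 < ρ) :
    D.carrier ∩ Metric.ball (D.pt i) ρ ≠ {z : ℂ | (D.pt i).im < z.im} ∩ Metric.ball (D.pt i) ρ := by
  obtain ⟨hw1, hw2, hw3⟩ := witness_dir hu hu1
  set w : ℂ := Complex.I * (1 - u) with hw
  set t : ℝ := min ρ ρ₀ / 4 with ht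
  have hmin : 0 < min ρ ρ₀ := lt_min hρ hρ₀
  have ht0 : 0 < t := by positivity
  set z : ℂ := D.pt i + (t : ℂ) * w with hz
  have hdist : dist z (D.pt i) < min ρ ρ₀ := by
    rw [dist_eq_norm, hz, add_sub_cancel_left, norm_mul, Complex.norm_real, Real.norm_of_nonneg ht0.le]
    calc t * ‖w‖ ≤ t * 2 := by gcongr
      _ = min ρ ρ₀ / 2 := by rw [ht]; ring
      _ < min ρ ρ₀ := by linarith
  have hzρ : z ∈ Metric.ball (D.pt i) ρ := (hdist.trans_le (min_le_left _ _))
  have hzρ₀ : z ∈ Metric.ball (D.pt i) ρ₀ := (hdist.trans_le (min_le_right _ _))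
  have hzim : (D.pt i).im < z.im := by
    rw [hz, Complex.add_im, Complex.mul_im, Complex.ofReal_re, Complex.ofReal_im, zero_mul, add_zero]
    have : 0 < t * w.im := mul_pos ht0 hw1
    linarith
  intro hEq
  have hzD : z ∈ D.carrier := by
    have : z ∈ {z : ℂ | (D.pt i).im < z.im} ∩ Metric.ball (D.pt i) ρ := ⟨hzim, hzρ⟩
    rw [← hEq] at this
    exact this.1
  have hz' : z ∈ D.carrier ∩ Metric.ball (D.pt i) ρ₀ := ⟨hzD, hzρ₀⟩
  rw [h] at hz'
  have hpos := hz'.1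
  simp only [Set.mem_setOf_eq, hz, add_sub_cancel_left] at hpos
  have key : ((starRingEnd ℂ) u * ((t : ℂ) * w)).im = t * ((starRingEnd ℂ) u * w).im := by
    have e : (starRingEnd ℂ) u * ((t : ℂ) * w) = (t : ℂ) * ((starRingEnd ℂ) u * w) := by ring
    rw [e, Complex.im_ofReal_mul]
  rw [key] at hpos
  have : t * ((starRingEnd ℂ) u * w).im < 0 := mul_neg_of_pos_of_neg ht0 hw2
  linarith


/-- Sixth roots of unity are unit complex numbers. -/
theorem norm_eq_one_of_pow_six {u : ℂ} (hu : u ^ 6 = 1) : ‖u‖ = 1 := by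
  have h : ‖u‖ ^ 6 = 1 := by rw [← norm_pow, hu, norm_one]
  exact (pow_eq_one_iff_of_nonneg (norm_nonneg u) (by norm_num)).1 h

/-- **`R` IS SILENT ON EVERY DOMAIN WITH A TILTED OR FLIPPED FLAT PIECE AT A MARKED POINT**
(positive form, as `obsLimitRBody_unitDisc`): the per-domain content of `HexObservableLimitR` is
provable outright, for every constant `c`, as soon as ONE marked point carries a flat piece of
orientation `u ≠ 1`.  In particular `R` carries no information on the five relative classes
`60°, 120°, 180°, 240°, 300°` of card 2's `FloorIdU` / card 3's `TwoPieceFloorIdentification`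
(K2), nor on the co-tilted classes `(u, u)`, `u ≠ 1` (those are reachable only through a
lattice-rotation covariance argument, which is OUTSIDE the typed `R`): the orientation transfer
S1 is load-bearing under `R` as typed. -/
theorem obsLimitRBody_of_flatAt {D : DobrushinDomain} {i : Fin 2} {u : ℂ} {ρ₀ : ℝ}
    (hu : ‖u‖ = 1) (hu1 : u ≠ 1) (hρ₀ : 0 < ρ₀) (h : FlatAt D i u ρ₀) (c : ℂ) :
    ObsLimitRBody c D := by
  intro ρ Λ m a b Φ L Lb ψ _ hρ hflat
  exact absurd (hflat i) (rFlat_false_of_flatAt hu hu1 hρ₀ h ρ hρ)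

/-- The six-orientation version (the lattice half-plane classes `u ^ 6 = 1`). -/
theorem obsLimitRBody_of_flatAt_rootOfUnity {D : DobrushinDomain} {i : Fin 2} {u : ℂ} {ρ₀ : ℝ}
    (hu : u ^ 6 = 1) (hu1 : u ≠ 1) (hρ₀ : 0 < ρ₀) (h : FlatAt D i u ρ₀) (c : ℂ) :
    ObsLimitRBody c D :=
  obsLimitRBody_of_flatAt (norm_eq_one_of_pow_six hu) hu1 hρ₀ h c

/-- Card 3's two-piece flat pinning with the orientations made explicit (`IsFlatPinned D ρ` of
`BridgePointGermTransferSketch.lean` is `∃ u, IsFlatPinnedWith D u ρ`). -/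
def IsFlatPinnedWith (D : DobrushinDomain) (u : Fin 2 → ℂ) (ρ : ℝ) : Prop :=
  0 < ρ ∧ ∀ i : Fin 2, u i ^ 6 = 1 ∧ FlatAt D i (u i) ρ

/-- Verbatim copy of card 3's `IsFlatPinned`. -/
def IsFlatPinned (D : DobrushinDomain) (ρ : ℝ) : Prop :=
  0 < ρ ∧ ∀ i : Fin 2, ∃ u : ℂ, u ^ 6 = 1 ∧
    D.carrier ∩ Metric.ball (D.pt i) ρ =
      {z : ℂ | 0 < ((starRingEnd ℂ) u * (z - D.pt i)).im} ∩ Metric.ball (D.pt i) ρ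

theorem isFlatPinned_iff (D : DobrushinDomain) (ρ : ℝ) :
    IsFlatPinned D ρ ↔ ∃ u : Fin 2 → ℂ, IsFlatPinnedWith D u ρ := by
  constructor
  · rintro ⟨hρ, h⟩
    choose u hu using h
    exact ⟨u, hρ, fun i => hu i⟩
  · rintro ⟨u, hρ, h⟩
    exact ⟨hρ, fun i => ⟨u i, h i⟩⟩

/-- **OF THE 36 ORIENTATION PAIRS OF K2, `R` SPEAKS ABOUT ONE.**  If either orientation differs
from `1`, the content of `R` at `D` is free. -/
theorem obsLimitRBody_of_isFlatPinnedWith {D : DobrushinDomain} {u : Fin 2 → ℂ} {ρ : ℝ}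
    (h : IsFlatPinnedWith D u ρ) (hu : ∃ i, u i ≠ 1) (c : ℂ) : ObsLimitRBody c D := by
  obtain ⟨i, hi⟩ := hu
  exact obsLimitRBody_of_flatAt_rootOfUnity (h.2 i).1 hi h.1 (h.2 i).2 c

/-- … in particular on every domain of NONZERO RELATIVE CLASS (`u 0 ≠ u 1`), which no global
lattice symmetry maps to the co-oriented class. -/
theorem obsLimitRBody_of_relativeClass_ne {D : DobrushinDomain} {u : Fin 2 → ℂ} {ρ : ℝ}
    (h : IsFlatPinnedWith D u ρ) (hu : u 0 ≠ u 1) (c : ℂ) : ObsLimitRBody c D := by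
  by_cases h0 : u 0 = 1
  · exact obsLimitRBody_of_isFlatPinnedWith h ⟨1, fun h1 => hu (h0.trans h1.symm)⟩ c
  · exact obsLimitRBody_of_isFlatPinnedWith h ⟨0, h0⟩ c

/-- Conversely the co-oriented pair `(1, 1)` is exactly `R`'s two-ball premise. -/
theorem isFlatPinnedWith_one_iff (D : DobrushinDomain) (ρ : ℝ) :
    IsFlatPinnedWith D (fun _ => 1) ρ ↔
      0 < ρ ∧ ∀ i : Fin 2, D.carrier ∩ Metric.ball (D.pt i) ρ =
        {z : ℂ | (D.pt i).im < z.im} ∩ Metric.ball (D.pt i) ρ := by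
  unfold IsFlatPinnedWith
  simp only [one_pow, true_and]
  exact and_congr Iff.rfl (forall_congr' fun i => flatAt_one_iff D i ρ)

/-- `HexObservableLimitR` is equivalent to itself RESTRICTED to domains without any tilted/flipped
flat piece at a marked point: the hypothesis of the crux never constrains the observable on the
classes K2 must cover beyond `(1, 1)`. -/
theorem obsLimitR_iff_untilted :
    SAWDefectDecoherence.HexObservableLimitR ↔
      ∃ c : ℂ, c ≠ 0 ∧ ∀ D : DobrushinDomain,
        (∀ (i : Fin 2) (u : ℂ) (ρ₀ : ℝ), 0 < ρ₀ → ‖u‖ = 1 → u ≠ 1 → ¬ FlatAt D i u ρ₀) →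
          ObsLimitRBody c D := by
  rw [obsLimitR_iff_body]
  constructor
  · rintro ⟨c, hc, h⟩
    exact ⟨c, hc, fun D _ => h D⟩
  · rintro ⟨c, hc, h⟩
    refine ⟨c, hc, fun D => ?_⟩
    by_cases hD : ∃ (i : Fin 2) (u : ℂ) (ρ₀ : ℝ), 0 < ρ₀ ∧ ‖u‖ = 1 ∧ u ≠ 1 ∧ FlatAt D i u ρ₀
    · obtain ⟨i, u, ρ₀, hρ₀, hu, hu1, hF⟩ := hD
      exact obsLimitRBody_of_flatAt hu hu1 hρ₀ hF c
    · push Not at hD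
      exact h D fun i u ρ₀ hρ₀ hu hu1 hF => hD i u ρ₀ hρ₀ hu hu1 hF

/-! ## §9 The per-domain reading of the crux is observable-free on the disc and on every tilted class -/

/-- The conclusion of the crux AT ONE Dobrushin domain (DCS Conjecture 1 at `D`). -/
def ConclusionAt (D : DobrushinDomain) : Prop :=
  ∀ a b : ℝ → HexVertex, IsEmbEndpointApprox hexGraph hexCenter D a b →
    ConvergesInLawToSLE ((8 : ℝ≥0) / 3) D
      (fun δ (γ : HexDomainSAW D.carrier δ (a δ) (b δ)) => γ.curve)
      (fun δ => hexSAWLaw D.carrier δ (a δ) (b δ))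

theorem hexConjecture_iff_forall_conclusionAt :
    SAWDevelopingMap.HexConjecture ↔ ∀ D, ConclusionAt D := Iff.rfl

/-- The PER-DOMAIN crux: the content of `R` at `D` (for some nonzero constant) and tightness give
DCS Conjecture 1 at the same `D`. -/
def CruxPerDomain : Prop :=
  ∀ D : DobrushinDomain, (∃ c : ℂ, c ≠ 0 ∧ ObsLimitRBody c D) → SAWDefectDecoherence.HexTight →
    ConclusionAt D

/-- The per-domain crux implies the crux… -/
theorem crux_of_perDomain (h : CruxPerDomain) : SAWDefectDecoherence.ObservableToSLER := by
  intro hO hT D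
  obtain ⟨c, hc, hb⟩ := obsLimitR_iff_body.1 hO
  exact h D ⟨c, hc, hb D⟩ hT

/-- … but it contains `HexTight → DCS Conjecture 1 on the unit disc` with NO observable input
(`obsLimitRBody_unitDisc`), -/
theorem perDomain_disc (h : CruxPerDomain) (hT : SAWDefectDecoherence.HexTight) :
    ConclusionAt DobrushinDomain.unitDisc :=
  h _ ⟨1, one_ne_zero, obsLimitRBody_unitDisc 1⟩ hT

/-- … and likewise on every two-piece flat domain with a tilted/flipped piece.  MORAL (typed): the
crux is irreducibly a TRANSFER statement — `R` on the co-oriented flat class must be transported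
to domains where `R` says nothing; no line can consume `R` only at the target domain. -/
theorem perDomain_tilted (h : CruxPerDomain) (hT : SAWDefectDecoherence.HexTight)
    {D : DobrushinDomain} {u : Fin 2 → ℂ} {ρ : ℝ} (hD : IsFlatPinnedWith D u ρ) (hu : ∃ i, u i ≠ 1) :
    ConclusionAt D :=
  h _ ⟨1, one_ne_zero, obsLimitRBody_of_isFlatPinnedWith hD hu 1⟩ hT

/-- The per-domain crux splits as: the crux itself PLUS the observable-free conjecture on every
domain where `R`'s premise fails for all radii. -/
theorem perDomain_iff :
    CruxPerDomain ↔
      SAWDefectDecoherence.ObservableToSLER ∧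
        ∀ D : DobrushinDomain, (∃ c : ℂ, c ≠ 0 ∧ ObsLimitRBody c D) →
          SAWDefectDecoherence.HexTight → ConclusionAt D :=
  ⟨fun h => ⟨crux_of_perDomain h, h⟩, fun h => h.2⟩

/-! ## §10 `RootRenewal` (card 1's typed a-priori input): the two defects, at list level

Verbatim copies of `row`, `IsRenewalRow`, `noRenewalObs`, `Z` from `RootRenewalSketch.lean`
(namespace `…Cruxes.ObservableToSLER.RootRenewal`, not importable from here), a list-level alias,
and the two combinatorial facts behind the triage witnesses (TRIAGE-r1-2 / r1-3): (a) for a target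
BELOW the window a "renewal row" in the typed sense exists iff the walk never reaches that row
(vacuous split `k = length`), so `noRenewalObs` is exactly the mass REACHING the top of the window;
(b) a vertex at or above row `h` followed LATER by a vertex below row `h` kills the renewal at `h`
(U-profile).  With (b), any domain forcing every walk through a high arch and back to a low target
(half-ball patch + width-one U-corridor, cf. the landed corridor engine
`Theorems/BoundaryClosureNegative_*`) gives `noRenewalObs = Z > ε Z`: `RootRenewal` is false for
every `K, d, R₀`; the lattice realisation of the forcing domain is §12 (`not_rootRenewal`). -/

namespace RootRenewalDefects

open Classical

/-- Row of a honeycomb vertex (copy). -/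
def row (v : HexVertex) : ℤ := v.1 1

/-- Copy of card 1's `IsRenewalRow`. -/
def IsRenewalRow {Λ : Finset HexVertex} {a z : Sym2 HexVertex} (γ : HexMidEdgeSAW Λ a z) (h : ℤ) :
    Prop :=
  ∃ k : ℕ, (∀ v ∈ γ.verts.take k, row v < h) ∧ (∀ v ∈ γ.verts.drop k, h ≤ row v)

/-- The same predicate on a bare vertex list. -/
def IsRenewalRowList (l : List HexVertex) (h : ℤ) : Prop :=
  ∃ k : ℕ, (∀ v ∈ l.take k, row v < h) ∧ (∀ v ∈ l.drop k, h ≤ row v)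

theorem isRenewalRow_iff_list {Λ : Finset HexVertex} {a z : Sym2 HexVertex}
    (γ : HexMidEdgeSAW Λ a z) (h : ℤ) : IsRenewalRow γ h ↔ IsRenewalRowList γ.verts h := Iff.rfl

/-- VACUOUS SPLIT 1: a list entirely below row `h` "has renewal row `h`" (`k = length`). -/
theorem isRenewalRowList_of_forall_lt {l : List HexVertex} {h : ℤ} (hl : ∀ v ∈ l, row v < h) :
    IsRenewalRowList l h :=
  ⟨l.length, fun v hv => hl v (List.mem_of_mem_take hv), by simp⟩

/-- VACUOUS SPLIT 2: a list entirely at or above row `h` "has renewal row `h`" (`k = 0`). -/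
theorem isRenewalRowList_of_forall_ge {l : List HexVertex} {h : ℤ} (hl : ∀ v ∈ l, h ≤ row v) :
    IsRenewalRowList l h :=
  ⟨0, by simp, fun v hv => hl v (List.mem_of_mem_drop hv)⟩

/-- **DEFECT (a): LOW TARGET.**  If the LAST vertex lies below row `h`, the typed renewal at `h`
holds iff the whole list lies below row `h`. -/
theorem isRenewalRowList_iff_of_getLast_lt {l : List HexVertex} {h : ℤ} (hne : l ≠ [])
    (hlast : row (l.getLast hne) < h) : IsRenewalRowList l h ↔ ∀ v ∈ l, row v < h := by
  refine ⟨?_, isRenewalRowList_of_forall_lt⟩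
  rintro ⟨k, hk1, hk2⟩
  by_cases hk : l.length ≤ k
  · intro v hv
    exact hk1 v (by rwa [List.take_of_length_le hk])
  · push Not at hk
    exfalso
    have hmem : l.getLast hne ∈ l.drop k := by
      rw [List.getLast_eq_getElem]
      have : l.length - 1 - k + k = l.length - 1 := by omega
      have hlt : l.length - 1 - k < (l.drop k).length := by simp; omega
      have := List.getElem_drop (xs := l) (i := k) (j := l.length - 1 - k) (h := hlt)
      rw [List.mem_iff_getElem]
      refine ⟨l.length - 1 - k, hlt, ?_⟩
      rw [List.getElem_drop]
      congr 1
      omega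
    exact absurd (hk2 _ hmem) (not_le.2 hlast)

/-- **DEFECT (b): U-PROFILE.**  A vertex at or above row `h` followed later by a vertex below row
`h` excludes the typed renewal at `h`. -/
theorem not_isRenewalRowList_of_high_then_low {l : List HexVertex} {h : ℤ} {i j : ℕ}
    (hij : i < j) (hj : j < l.length) (hi : h ≤ row (l[i]'(hij.trans hj))) (hlow : row (l[j]) < h) :
    ¬ IsRenewalRowList l h := by
  rintro ⟨k, hk1, hk2⟩
  by_cases hk : k ≤ i
  · -- `l[j]` lies in the suffix
    have hmem : l[j] ∈ l.drop k := by
      rw [List.mem_iff_getElem]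
      refine ⟨j - k, by simp; omega, ?_⟩
      rw [List.getElem_drop]
      congr 1
      omega
    exact absurd (hk2 _ hmem) (not_le.2 hlow)
  · -- `l[i]` lies in the prefix
    push Not at hk
    have hmem : l[i]'(hij.trans hj) ∈ l.take k := by
      rw [List.mem_iff_getElem]
      refine ⟨i, by simp; omega, ?_⟩
      rw [List.getElem_take]
    exact absurd (hk1 _ hmem) (not_lt.2 hi)

/-- Copy of card 1's `noRenewalObs`. -/
def noRenewalObs (Λ : Finset HexVertex) (a z : Sym2 HexVertex) (x σ : ℝ) (h₁ h₂ : ℤ) : ℂ :=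
  ∑ γ : HexMidEdgeSAW Λ a z,
    if ∀ h : ℤ, h₁ < h → h ≤ h₂ → ¬ IsRenewalRow γ h then γ.weight x σ else 0

/-- Copy of card 1's `Z`. -/
def Z (Λ : Finset HexVertex) (a z : Sym2 HexVertex) : ℝ :=
  (hexParafermionicObservable Λ a hexCriticalFugacity 0 z).re

/-- Copy of card 1's `RootRenewal` (RR). -/
def RootRenewal : Prop :=
  ∀ ε : ℝ, 0 < ε → ∃ K : ℕ, ∀ d : ℕ, 1 ≤ d → ∃ R₀ : ℝ, 0 < R₀ ∧
    ∀ (Λ : Finset HexVertex) (m : ℤ) (u w : HexVertex) (z : Sym2 HexVertex),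
      hexDomainSimplyConnected Λ → hexGraph.Adj u w → w ∈ Λ → row w = m + d →
      (∀ v : HexVertex, dist (hexCenter v) (hexCenter w) ≤ R₀ → (v ∈ Λ ↔ m ≤ row v)) →
      z ∈ hexDomainMidEdges Λ → (∀ v ∈ z, R₀ ≤ dist (hexCenter v) (hexCenter w)) →
        (noRenewalObs Λ s(u, w) z hexCriticalFugacity 0 (m + d) (m + 2 ^ K * d)).re
          ≤ ε * Z Λ s(u, w) z

/-- DEFECT (a) AT THE LEVEL OF `noRenewalObs`: for a walk whose target mid-edge lies below the
window, "no typed renewal row in `(h₁, h₂]`" is EXACTLY "some vertex at or above row `h₂`". -/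
theorem noRenewal_iff_reaches_top {Λ : Finset HexVertex} {a z : Sym2 HexVertex}
    (γ : HexMidEdgeSAW Λ a z) {h₁ h₂ : ℤ} (hz : ∀ v ∈ z, row v ≤ h₁) (hne : γ.verts ≠ [])
    (h12 : h₁ < h₂) :
    (∀ h : ℤ, h₁ < h → h ≤ h₂ → ¬ IsRenewalRow γ h) ↔ ∃ v ∈ γ.verts, h₂ ≤ row v := by
  have hlast : row (γ.verts.getLast hne) ≤ h₁ :=
    hz _ (γ.getLast_mem _ (List.getLast?_eq_some_getLast hne))
  have key : ∀ h : ℤ, h₁ < h → (IsRenewalRow γ h ↔ ∀ v ∈ γ.verts, row v < h) := fun h hh =>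
    (isRenewalRow_iff_list γ h).trans (isRenewalRowList_iff_of_getLast_lt hne (by omega))
  constructor
  · intro H
    have := H h₂ h12 le_rfl
    rw [key h₂ h12] at this
    push Not at this
    exact this
  · rintro ⟨v, hv, hv2⟩ h hh1 hh2
    rw [key h hh1]
    push Not
    exact ⟨v, hv, by omega⟩

/-- DEFECT (b) AT THE LEVEL OF `noRenewalObs`: if EVERY walk of `Λ` from `a` to `z` passes a
vertex at or above row `h₂` and LATER a vertex at or below row `h₁` (forced U-profile), then
`noRenewalObs` over the window `(h₁, h₂]` is the full observable. -/
theorem noRenewalObs_eq_of_forcedU {Λ : Finset HexVertex} {a z : Sym2 HexVertex} {x σ : ℝ}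
    {h₁ h₂ : ℤ}
    (H : ∀ γ : HexMidEdgeSAW Λ a z, ∃ i j : ℕ, ∃ hij : i < j, ∃ hj : j < γ.verts.length,
      h₂ ≤ row (γ.verts[i]'(hij.trans hj)) ∧ row (γ.verts[j]) ≤ h₁) :
    noRenewalObs Λ a z x σ h₁ h₂ = hexParafermionicObservable Λ a x σ z := by
  unfold noRenewalObs hexParafermionicObservable
  refine Finset.sum_congr rfl fun γ _ => ?_
  rw [if_pos]
  intro h hh1 hh2
  obtain ⟨i, j, hij, hj, hi, hlow⟩ := H γ
  rw [isRenewalRow_iff_list]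
  exact not_isRenewalRowList_of_high_then_low hij hj (by omega) (by omega)

/-- Hence on a forcing domain with at least one walk, RR's inequality fails for every `ε < 1`:
`noRenewalObs = Z > ε Z`. -/
theorem rr_ineq_false_of_forcedU {Λ : Finset HexVertex} {a z : Sym2 HexVertex} {h₁ h₂ : ℤ}
    (H : ∀ γ : HexMidEdgeSAW Λ a z, ∃ i j : ℕ, ∃ hij : i < j, ∃ hj : j < γ.verts.length,
      h₂ ≤ row (γ.verts[i]'(hij.trans hj)) ∧ row (γ.verts[j]) ≤ h₁)
    (hZ : 0 < Z Λ a z) {ε : ℝ} (hε : ε < 1) :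
    ¬ (noRenewalObs Λ a z hexCriticalFugacity 0 h₁ h₂).re ≤ ε * Z Λ a z := by
  rw [noRenewalObs_eq_of_forcedU H]
  unfold Z at *
  intro h
  nlinarith

/-- `Z > 0` as soon as one walk exists (all spin-`0` weights are `x_c^ℓ > 0`). -/
theorem Z_pos_of_nonempty {Λ : Finset HexVertex} {a z : Sym2 HexVertex}
    (hne : Nonempty (HexMidEdgeSAW Λ a z)) : 0 < Z Λ a z := by
  unfold Z
  rw [hexParafermionicObservable_def, Complex.re_sum]
  refine Finset.sum_pos (fun γ _ => ?_) ⟨hne.some, Finset.mem_univ _⟩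
  rw [HexMidEdgeSAW.weight_zero_spin, ← Complex.ofReal_pow, Complex.ofReal_re]
  exact pow_pos hexCriticalFugacity_pos_lt_one.1 _

end RootRenewalDefects


/-! ## §11 Targets (lead's stuck stubs): none filed (no line picked yet; `stuck_stubs = []`).  Near-misses: none. -/

/-! ## §12 `RootRenewal` IS FALSE — the forcing domain, fully checked (cycle 2; was the near-miss)

The forcing domain of §10 (b), realised in the `(j, r)` face coordinates `fj j r` of the landed
lattice engine `Theorems/BoundaryClosureNegative_Lattice` (no pocket: a SLANTED box
`{0 ≤ r ≤ H−1, −4N−2 ≤ j ≤ 2N+2}` containing the exact half-ball patch of radius `R₀ ≤ N := ⌈R₀⌉₊`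
about `w = fj 0 1`, the top row `r = H := 2^K + 2N + 4` over `−4N−2 ≤ j ≤ jD+1`, and the slanted
double column `{jD, jD+1} × {0 … H}`, `jD := 2N+6`; target `z = s(fj jD 0, fj (jD+1) (−1))`).
Checked: connected complement by row/column escapes (`simplyConnected_Lam`), the patch clause
(`patch_clause`: `|Δ re| ≤ dist`, `|Δ im| ≤ dist`, `√3 > 17/10`), the far clause, the forced
U-profile (`forcedU`: the last index outside the lower down column is adjacent to it, hence on
the top row, by the purely combinatorial neighbour lemma `row_eq_Ht_of_adj_DownLow`), and the
existence of a walk (`nonempty_saw`: a reachability path inside `Λ ∖ {u}` converted to a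
mid-edge SAW).  Hence **`not_rootRenewal : ¬ RootRenewal`** for the verbatim copy of card 1's
statement (§10). -/

namespace RootRenewalDefects

open Summit.CriticalPhenomena.SAWScalingLimit.Theorems.BoundaryClosure.Negative
open Classical

/-! ### The forcing domain in `(j, r)` coordinates -/

section Forcing

variable (K N : ℕ)

/-- Height of the top row: above the window top `2^K` and above the ball. -/
def Ht : ℤ := 2 ^ K + 2 * N + 4

/-- Index of the (even) down column. -/
def jD : ℤ := 2 * N + 6

/-- The slanted box: rows `0 … Ht-1`, indices `-4N-2 … 2N+2`. -/
def InBox (j r : ℤ) : Prop := 0 ≤ r ∧ r ≤ Ht K N - 1 ∧ -(4 * N : ℤ) - 2 ≤ j ∧ j ≤ 2 * N + 2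

/-- The top row `Ht`, indices `-4N-2 … jD+1`. -/
def InTop (j r : ℤ) : Prop := r = Ht K N ∧ -(4 * N : ℤ) - 2 ≤ j ∧ j ≤ jD N + 1

/-- The slanted double column `{jD, jD+1} × {0 … Ht}`. -/
def InDown (j r : ℤ) : Prop := 0 ≤ r ∧ r ≤ Ht K N ∧ (j = jD N ∨ j = jD N + 1)

/-- Membership predicate of the forcing domain. -/
def InLam (j r : ℤ) : Prop := InBox K N j r ∨ InTop K N j r ∨ InDown K N j r

/-- A bounding box for the coordinates. -/
def Bnd : ℤ := 2 ^ K + 8 * N + 20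

/-- The finite box of faces with coordinates in `[-Bnd, Bnd]²`. -/
def bbox : Finset HexVertex :=
  ((Finset.Icc (-Bnd K N) (Bnd K N)) ×ˢ (Finset.Icc (-Bnd K N) (Bnd K N))).image fun p => fj p.1 p.2

/-- **The forcing domain** `Λ_{K,N}`. -/
def Lam : Finset HexVertex :=
  (bbox K N).filter fun v => InLam K N (jOf v) (rOf v)

variable {K N}

theorem Ht_ge : (2 : ℤ) ^ K + 4 ≤ Ht K N := by unfold Ht; omega

theorem one_le_two_pow : (1 : ℤ) ≤ 2 ^ K := by exact_mod_cast Nat.one_le_two_pow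

theorem InLam_bounds {j r : ℤ} (h : InLam K N j r) :
    -Bnd K N ≤ j ∧ j ≤ Bnd K N ∧ -Bnd K N ≤ r ∧ r ≤ Bnd K N := by
  have := @one_le_two_pow K
  unfold InLam InBox InTop InDown Ht jD at h; unfold Bnd
  omega

/-- Membership of a coordinate face in `Λ`. -/
theorem fj_mem_Lam_iff {j r : ℤ} : fj j r ∈ Lam K N ↔ InLam K N j r := by
  unfold Lam
  rw [Finset.mem_filter, jOf_fj, rOf_fj]
  constructor
  · exact fun h => h.2
  · intro h
    refine ⟨?_, h⟩
    obtain ⟨h1, h2, h3, h4⟩ := InLam_bounds h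
    unfold bbox
    rw [Finset.mem_image]
    exact ⟨(j, r), by simp [Finset.mem_Icc, h1, h2, h3, h4], rfl⟩

theorem mem_Lam_iff {v : HexVertex} : v ∈ Lam K N ↔ InLam K N (jOf v) (rOf v) := by
  rw [← fj_jOf_rOf v, fj_mem_Lam_iff, jOf_fj, rOf_fj]

theorem fj_mem_compl_iff {j r : ℤ} : fj j r ∈ (↑(Lam K N) : Set HexVertex)ᶜ ↔ ¬ InLam K N j r := by
  rw [Set.mem_compl_iff, Finset.mem_coe, fj_mem_Lam_iff]

/-- All faces of `Λ` have nonnegative row. -/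
theorem row_nonneg_of_InLam {j r : ℤ} (h : InLam K N j r) : 0 ≤ r := by
  have := @one_le_two_pow K
  unfold InLam InBox InTop InDown Ht at h; omega

/-! ### The complement is connected: escape routes -/

/-- Faces of negative rows are in the complement. -/
theorem compl_of_neg {j r : ℤ} (hr : r < 0) : fj j r ∈ (↑(Lam K N) : Set HexVertex)ᶜ :=
  fj_mem_compl_iff.2 fun h => absurd (row_nonneg_of_InLam h) (not_le.2 hr)

/-- Faces far to the right (`j ≥ jD + 2`) are in the complement. -/
theorem compl_of_right {j r : ℤ} (hj : jD N + 2 ≤ j) : fj j r ∈ (↑(Lam K N) : Set HexVertex)ᶜ := by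
  rw [fj_mem_compl_iff]; unfold InLam InBox InTop InDown jD at *; omega

/-- Faces far to the left (`j ≤ -4N-3`) are in the complement. -/
theorem compl_of_left {j r : ℤ} (hj : j ≤ -(4 * N : ℤ) - 3) : fj j r ∈ (↑(Lam K N) : Set HexVertex)ᶜ := by
  rw [fj_mem_compl_iff]; unfold InLam InBox InTop InDown jD at *; omega

/-- Faces of the gap columns (`2N+3 ≤ j ≤ 2N+5`, rows `< Ht`) are in the complement. -/
theorem compl_of_gap {j r : ℤ} (hj : 2 * N + 3 ≤ j) (hj' : j ≤ 2 * N + 5) (hr : r < Ht K N) :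
    fj j r ∈ (↑(Lam K N) : Set HexVertex)ᶜ := by
  rw [fj_mem_compl_iff]; unfold InLam InBox InTop InDown jD at *; omega

/-- Faces above the top row are in the complement. -/
theorem compl_of_high {j r : ℤ} (hr : Ht K N < r) : fj j r ∈ (↑(Lam K N) : Set HexVertex)ᶜ := by
  rw [fj_mem_compl_iff]; unfold InLam InBox InTop InDown at *; omega

/-- The bottom row `-1` path to the base face `fj 0 (-1)`. -/
theorem rch_bottom (j : ℤ) : (fj j (-1), fj 0 (-1)) ∈ RchRel (↑(Lam K N) : Set HexVertex)ᶜ :=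
  rch_row_of_between (↑(Lam K N) : Set HexVertex)ᶜ (-1) j 0 fun i _ _ => compl_of_neg (by norm_num)

/-- From a complement face of a negative row to the base face. -/
theorem rch_of_neg {j r : ℤ} (hr : r < 0) : (fj j r, fj 0 (-1)) ∈ RchRel (↑(Lam K N) : Set HexVertex)ᶜ := by
  obtain ⟨j₁, hj₁, h₁⟩ : ∃ j₁ : ℤ, j₁ % 2 = 1 ∧ (fj j r, fj j₁ r) ∈ RchRel (↑(Lam K N) : Set HexVertex)ᶜ := by
    rcases Int.emod_two_eq_zero_or_one j with hj | hj
    · exact ⟨j + 1, by omega, rch_of_adj (compl_of_neg hr) (compl_of_neg hr) (adj_fj_succ j r)⟩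
    · exact ⟨j, hj, rch_rfl (compl_of_neg hr)⟩
  obtain ⟨n, hn⟩ : ∃ n : ℕ, (n : ℤ) = -1 - r := ⟨(-1 - r).toNat, by omega⟩
  have step2 : (fj j₁ r, fj j₁ (r + n)) ∈ RchRel (↑(Lam K N) : Set HexVertex)ᶜ :=
    rch_col_up (↑(Lam K N) : Set HexVertex)ᶜ hj₁ r n (compl_of_neg hr) fun i _ hi =>
      ⟨compl_of_neg (by omega), compl_of_neg (by omega)⟩
  rw [hn, show r + (-1 - r) = -1 by ring] at step2
  exact rch_trans (rch_trans h₁ step2) (rch_bottom j₁)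

/-- Right escape: from a face whose whole right half-row is free, down to the base face. -/
theorem rch_of_rightFree {j r : ℤ} (hr : 0 ≤ r) (hR : ∀ i, j ≤ i → fj i r ∈ (↑(Lam K N) : Set HexVertex)ᶜ) :
    (fj j r, fj 0 (-1)) ∈ RchRel (↑(Lam K N) : Set HexVertex)ᶜ := by
  set J : ℤ := 2 * (|j| + N + 4) with hJ
  have hjJ : j ≤ J := by have := le_abs_self j; have := abs_nonneg j; omega
  have hJeven : J % 2 = 0 := by omega
  have hJfar : jD N + 2 ≤ J := by have := abs_nonneg j; unfold jD; omega
  have step1 : (fj j r, fj J r) ∈ RchRel (↑(Lam K N) : Set HexVertex)ᶜ := rch_row (↑(Lam K N) : Set HexVertex)ᶜ r j J hjJ fun i hi _ => hR i hi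
  obtain ⟨n, hn⟩ : ∃ n : ℕ, (n : ℤ) = r + 1 := ⟨(r + 1).toNat, by omega⟩
  have step2 : (fj J r, fj J (r - n)) ∈ RchRel (↑(Lam K N) : Set HexVertex)ᶜ :=
    rch_col_down (↑(Lam K N) : Set HexVertex)ᶜ hJeven r n (hR J hjJ) fun i _ _ =>
      ⟨compl_of_right hJfar, compl_of_right (by omega)⟩
  rw [hn, show r - (r + 1) = -1 by ring] at step2
  exact rch_trans (rch_trans step1 step2) (rch_bottom J)

/-- Left escape. -/
theorem rch_of_leftFree {j r : ℤ} (hr : 0 ≤ r) (hL : ∀ i, i ≤ j → fj i r ∈ (↑(Lam K N) : Set HexVertex)ᶜ) :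
    (fj j r, fj 0 (-1)) ∈ RchRel (↑(Lam K N) : Set HexVertex)ᶜ := by
  set J : ℤ := -(2 * (|j| + 4 * N + 4)) with hJ
  have hjJ : J ≤ j := by have := neg_abs_le j; have := abs_nonneg j; omega
  have hJeven : J % 2 = 0 := by omega
  have hJfar : J + 1 ≤ -(4 * N : ℤ) - 3 := by have := abs_nonneg j; omega
  have step1 : (fj j r, fj J r) ∈ RchRel (↑(Lam K N) : Set HexVertex)ᶜ := rch_symm (rch_row (↑(Lam K N) : Set HexVertex)ᶜ r J j hjJ fun i _ hi => hL i hi)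
  obtain ⟨n, hn⟩ : ∃ n : ℕ, (n : ℤ) = r + 1 := ⟨(r + 1).toNat, by omega⟩
  have step2 : (fj J r, fj J (r - n)) ∈ RchRel (↑(Lam K N) : Set HexVertex)ᶜ :=
    rch_col_down (↑(Lam K N) : Set HexVertex)ᶜ hJeven r n (hL J hjJ) fun i _ _ =>
      ⟨compl_of_left (by omega), compl_of_left hJfar⟩
  rw [hn, show r - (r + 1) = -1 by ring] at step2
  exact rch_trans (rch_trans step1 step2) (rch_bottom J)

/-- Gap escape: from a face of the gap columns `2N+3 ≤ j ≤ 2N+5`, rows `0 … Ht-1`. -/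
theorem rch_of_gap {j r : ℤ} (hr : 0 ≤ r) (hr' : r < Ht K N) (hj : 2 * N + 3 ≤ j) (hj' : j ≤ 2 * N + 5) :
    (fj j r, fj 0 (-1)) ∈ RchRel (↑(Lam K N) : Set HexVertex)ᶜ := by
  -- move to the even face `J ∈ {2N+4}` of the same row inside the gap
  set J : ℤ := 2 * N + 4 with hJ
  have hJeven : J % 2 = 0 := by omega
  have step1 : (fj j r, fj J r) ∈ RchRel (↑(Lam K N) : Set HexVertex)ᶜ :=
    rch_row_of_between (↑(Lam K N) : Set HexVertex)ᶜ r j J fun i hi hi' =>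
      compl_of_gap (by omega) (by omega) hr'
  obtain ⟨n, hn⟩ : ∃ n : ℕ, (n : ℤ) = r + 1 := ⟨(r + 1).toNat, by omega⟩
  have step2 : (fj J r, fj J (r - n)) ∈ RchRel (↑(Lam K N) : Set HexVertex)ᶜ :=
    rch_col_down (↑(Lam K N) : Set HexVertex)ᶜ hJeven r n (compl_of_gap (by omega) (by omega) hr') fun i hi _ =>
      ⟨compl_of_gap (by omega) (by omega) (by omega), compl_of_gap (by omega) (by omega) (by omega)⟩
  rw [hn, show r - (r + 1) = -1 by ring] at step2
  exact rch_trans (rch_trans step1 step2) (rch_bottom J)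

/-- **Every complement face is joined to the base face inside the complement.** -/
theorem rch_compl {v : HexVertex} (hv : v ∈ (↑(Lam K N) : Set HexVertex)ᶜ) : (v, fj 0 (-1)) ∈ RchRel (↑(Lam K N) : Set HexVertex)ᶜ := by
  rw [← fj_jOf_rOf v] at hv ⊢
  generalize jOf v = j at hv ⊢
  generalize rOf v = r at hv ⊢
  rcases lt_or_ge r 0 with hr | hr
  · exact rch_of_neg hr
  rw [fj_mem_compl_iff] at hv
  have h2K := @one_le_two_pow K
  rcases lt_or_ge (Ht K N) r with hhi | hhi
  · -- above the top row: everything to the right is free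
    exact rch_of_rightFree hr fun i _ => compl_of_high hhi
  -- rows `0 … Ht`: locate the face
  by_cases hright : jD N + 2 ≤ j
  · exact rch_of_rightFree hr fun i hi => compl_of_right (hright.trans hi)
  by_cases hleft : j ≤ -(4 * N : ℤ) - 3
  · exact rch_of_leftFree hr fun i hi => compl_of_left (hi.trans hleft)
  -- remaining: the gap columns below the top row
  have hgap : 2 * N + 3 ≤ j ∧ j ≤ 2 * N + 5 ∧ r < Ht K N := by
    unfold InLam InBox InTop InDown jD at hv; unfold jD at hright; omega
  exact rch_of_gap hr hgap.2.2 hgap.1 hgap.2.1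

/-- **The forcing domain is simply connected** (connected complement). -/
theorem simplyConnected_Lam : hexDomainSimplyConnected (Lam K N) := by
  intro u v
  obtain ⟨hu, h0, p⟩ := rch_compl u.2
  obtain ⟨hv, h0', q⟩ := rch_compl v.2
  exact p.trans q.symm

end Forcing

section Instance

variable {K N : ℕ}

/-! ### The instance data of `RootRenewal` on the forcing domain -/

/-- The source face `w` (row `1`, the centre of the exact half-ball patch). -/
def wF : HexVertex := fj 0 1
/-- The other endpoint of the source mid-edge. -/
def uF : HexVertex := fj 1 1
/-- The target face (foot of the down column, row `0`). -/
def yF (N : ℕ) : HexVertex := fj (jD N) 0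
/-- The outer endpoint of the target mid-edge (row `-1`, outside the domain). -/
def yF' (N : ℕ) : HexVertex := fj (jD N + 1) (-1)
/-- The target mid-edge. -/
def zF (N : ℕ) : Sym2 HexVertex := s(yF N, yF' N)

theorem jD_even : jD N % 2 = 0 := by unfold jD; omega

theorem adj_uF_wF : hexGraph.Adj uF wF := by
  have := (adj_fj_succ 0 1).symm
  simpa [uF, wF] using this

theorem adj_yF_yF' : hexGraph.Adj (yF N) (yF' N) := by
  have := adj_fj_down (jD_even (N := N)) 0
  rwa [zero_sub] at this

theorem wF_mem : wF ∈ Lam K N := by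
  have := @one_le_two_pow K
  unfold wF; rw [fj_mem_Lam_iff]; left; unfold InBox Ht; omega

theorem yF_mem : yF N ∈ Lam K N := by
  have := @one_le_two_pow K
  unfold yF; rw [fj_mem_Lam_iff]; right; right; unfold InDown Ht; omega

theorem yF'_not_mem : yF' N ∉ Lam K N := by
  unfold yF'; rw [fj_mem_Lam_iff]; exact fun h => absurd (row_nonneg_of_InLam h) (by norm_num)

theorem uF_not_InDown : ¬ InDown K N 1 1 := by unfold InDown jD; omega
theorem wF_not_InDown : ¬ InDown K N 0 1 := by unfold InDown jD; omega

theorem row_fj (j r : ℤ) : row (fj j r) = r := by unfold row; exact fj_fst_one j r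

theorem row_wF : row wF = (0 : ℤ) + ((1 : ℕ) : ℤ) := by unfold wF; rw [row_fj]; norm_num

theorem wF_ne_yF : wF ≠ yF N := by
  unfold wF yF; intro h; have := (fj_inj.1 h).2; omega

theorem wF_ne_yF' : wF ≠ yF' N := by
  unfold wF yF'; intro h; have := (fj_inj.1 h).2; omega

theorem wF_not_mem_zF : wF ∉ zF N := by
  unfold zF; intro h
  rcases Sym2.mem_iff.1 h with h | h
  · exact wF_ne_yF h
  · exact wF_ne_yF' h

theorem a_ne_zF : s(uF, wF) ≠ zF N := fun h => wF_not_mem_zF (h ▸ Sym2.mem_mk_right uF wF)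

theorem zF_mem_midEdges : zF N ∈ hexDomainMidEdges (Lam K N) :=
  ⟨(SimpleGraph.mem_edgeSet hexGraph).2 adj_yF_yF', yF N, Sym2.mem_mk_left _ _, yF_mem⟩

theorem a_mem_midEdges : s(uF, wF) ∈ hexDomainMidEdges (Lam K N) :=
  ⟨(SimpleGraph.mem_edgeSet hexGraph).2 adj_uF_wF, wF, Sym2.mem_mk_right _ _, wF_mem⟩

/-! ### Metric facts: the patch clause and the far clause -/

theorem re_wF : (hexCenter wF).re = 1 := by
  unfold wF; rw [re_hexCenter_fj]; norm_num

theorem im_wF_le : (hexCenter wF).im ≤ (5 / 3) * (Real.sqrt 3 / 2) := by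
  have := (im_hexCenter_fj_bounds 0 1).2
  unfold wF; push_cast at this; linarith

/-- **The patch clause**: inside the ball of radius `R₀ ≤ N` about `w`, the forcing domain is
exactly the half-lattice of nonnegative rows. -/
theorem patch_clause {R₀ : ℝ} (hRN : R₀ ≤ N) (v : HexVertex)
    (hv : dist (hexCenter v) (hexCenter wF) ≤ R₀) : v ∈ Lam K N ↔ 0 ≤ row v := by
  rw [← fj_jOf_rOf v] at hv ⊢
  generalize jOf v = j at hv ⊢
  generalize rOf v = r at hv ⊢
  rw [row_fj, fj_mem_Lam_iff]
  refine ⟨row_nonneg_of_InLam, fun hr => Or.inl ?_⟩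
  have h2K := @one_le_two_pow K
  rw [dist_eq_norm] at hv
  have hre := (Complex.abs_re_le_norm (hexCenter (fj j r) - hexCenter wF)).trans hv
  have him := (Complex.abs_im_le_norm (hexCenter (fj j r) - hexCenter wF)).trans hv
  rw [Complex.sub_re, re_hexCenter_fj, re_wF] at hre
  rw [Complex.sub_im] at him
  have him' : (hexCenter (fj j r)).im - (hexCenter wF).im ≤ N := (le_abs_self _).trans (him.trans hRN)
  have hlo := (im_hexCenter_fj_bounds j r).1
  have hw := im_wF_le
  obtain ⟨h3, h17, -⟩ := sqrt_three_bounds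
  have hre' : |((j : ℝ) + r + 1) / 2 - 1| ≤ N := hre.trans hRN
  rw [abs_le] at hre'
  obtain ⟨hre1, hre2⟩ := hre'
  -- row bound: r ≤ 2N + 3
  have hrow : r ≤ 2 * N + 3 := by
    by_contra hc
    push Not at hc
    have hc' : (2 * N + 4 : ℝ) ≤ r := by exact_mod_cast hc
    nlinarith
  have hj1 : -(4 * N : ℤ) - 2 ≤ j := by
    have : (-(2 * N : ℝ)) + 1 ≤ j + r := by linarith
    have : -(2 * (N : ℤ)) + 1 ≤ j + r := by exact_mod_cast this
    omega
  have hj2 : j ≤ 2 * N + 2 := by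
    have : (j : ℝ) + r ≤ 2 * N + 1 := by linarith
    have : j + r ≤ 2 * (N : ℤ) + 1 := by exact_mod_cast this
    omega
  unfold InBox Ht
  omega

/-- **The far clause**: both endpoints of the target mid-edge are at distance `≥ N ≥ R₀` from `w`. -/
theorem far_clause {R₀ : ℝ} (hRN : R₀ ≤ N) (v : HexVertex) (hv : v ∈ zF N) :
    R₀ ≤ dist (hexCenter v) (hexCenter wF) := by
  have key : ∀ j r : ℤ, j + r = jD N → R₀ ≤ dist (hexCenter (fj j r)) (hexCenter wF) := by
    intro j r hjr
    rw [dist_eq_norm]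
    refine le_trans ?_ (Complex.abs_re_le_norm _)
    rw [Complex.sub_re, re_hexCenter_fj, re_wF]
    have : ((j : ℝ) + r) = jD N := by exact_mod_cast hjr
    unfold jD at this; push_cast at this
    rw [abs_of_nonneg (by linarith)]
    linarith
  unfold zF yF yF' at hv
  rcases Sym2.mem_iff.1 hv with rfl | rfl
  · exact key _ _ (by ring)
  · exact key _ _ (by ring)

/-! ### The forced U-profile -/

/-- The lower part of the down column. -/
def DownLow (K N : ℕ) (v : HexVertex) : Prop := InDown K N (jOf v) (rOf v) ∧ rOf v < Ht K N

/-- **Neighbour lemma**: a vertex of `Λ` outside the lower down column but adjacent to it lies on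
the top row. -/
theorem row_eq_Ht_of_adj_DownLow {v v' : HexVertex} (hv' : v' ∈ Lam K N) (hnd : ¬ DownLow K N v')
    (hv : DownLow K N v) (hadj : hexGraph.Adj v' v) : rOf v' = Ht K N := by
  rw [← fj_jOf_rOf v, ← fj_jOf_rOf v'] at hadj
  rw [mem_Lam_iff] at hv'
  unfold DownLow at hnd hv
  generalize jOf v = j at *
  generalize rOf v = r at *
  generalize jOf v' = j' at *
  generalize rOf v' = r' at *
  rw [adj_fj_iff] at hadj
  have h2K := @one_le_two_pow K
  unfold InLam InBox InTop InDown jD Ht at *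
  omega

/-- **Every walk of the forcing domain from the source mid-edge to the target mid-edge passes the
top row (row `Ht ≥ 2^K`) and then ends at the foot of the down column (row `0`).** -/
theorem forcedU (γ : HexMidEdgeSAW (Lam K N) s(uF, wF) (zF N)) :
    ∃ i j : ℕ, ∃ hij : i < j, ∃ hj : j < γ.verts.length,
      (0 : ℤ) + 2 ^ K * ((1 : ℕ) : ℤ) ≤ row (γ.verts[i]'(hij.trans hj)) ∧
        row (γ.verts[j]) ≤ (0 : ℤ) + ((1 : ℕ) : ℤ) := by
  set l := γ.verts with hl
  have hne : l ≠ [] := fun h => a_ne_zF (γ.eq_of_nil h)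
  have hlen : 0 < l.length := List.length_pos_of_ne_nil hne
  -- the last vertex is the foot `yF`
  have hlast : l.getLast hne = yF N := by
    have h1 : l.getLast hne ∈ zF N := γ.getLast_mem _ (List.getLast?_eq_some_getLast hne)
    have h2 : l.getLast hne ∈ Lam K N := γ.subset _ (List.getLast_mem hne)
    unfold zF at h1
    rcases Sym2.mem_iff.1 h1 with h | h
    · exact h
    · exact absurd (h ▸ h2) yF'_not_mem
  have hlastD : DownLow K N (l.getLast hne) := by
    rw [hlast]; unfold DownLow yF; rw [jOf_fj, rOf_fj]
    have h2K := @one_le_two_pow K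
    unfold InDown Ht; omega
  -- the first vertex is `uF` or `wF`, not in the lower down column
  have hfirst : ¬ DownLow K N (l[0]'hlen) := by
    have h0 : l[0]'hlen ∈ s(uF, wF) := γ.head_mem _ (by rw [List.head?_eq_getElem?, List.getElem?_eq_getElem hlen])
    unfold DownLow
    rcases Sym2.mem_iff.1 h0 with h | h <;> rw [h]
    · unfold uF; rw [jOf_fj, rOf_fj]; exact fun hh => uF_not_InDown hh.1
    · unfold wF; rw [jOf_fj, rOf_fj]; exact fun hh => wF_not_InDown hh.1
  -- the last index outside the lower down column
  set Q : ℕ → Prop := fun t => ∃ v, l[t]? = some v ∧ ¬ DownLow K N v with hQ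
  set t₀ := Nat.findGreatest Q (l.length - 1) with ht₀
  have hQ0 : Q 0 := ⟨l[0]'hlen, (List.getElem?_eq_getElem hlen), hfirst⟩
  have hQt₀ : Q t₀ := Nat.findGreatest_spec (P := Q) (Nat.zero_le _) hQ0
  have ht₀le : t₀ ≤ l.length - 1 := Nat.findGreatest_le _
  have hnotQlast : ¬ Q (l.length - 1) := by
    rintro ⟨v, hv, hvD⟩
    rw [List.getElem?_eq_getElem (by omega), Option.some_inj] at hv
    rw [← hv, ← List.getLast_eq_getElem hne] at hvD
    exact hvD hlastD
  have ht₀lt : t₀ < l.length - 1 := by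
    rcases ht₀le.lt_or_eq with h | h
    · exact h
    · exact absurd (h ▸ hQt₀) hnotQlast
  have hnotQ : ¬ Q (t₀ + 1) :=
    Nat.findGreatest_is_greatest (P := Q) (Nat.lt_succ_self _) (by omega)
  obtain ⟨v₀, hv₀, hv₀D⟩ := hQt₀
  have ht₀len : t₀ < l.length := by omega
  have ht₁len : t₀ + 1 < l.length := by omega
  rw [List.getElem?_eq_getElem ht₀len, Option.some_inj] at hv₀
  have hv₁D : DownLow K N (l[t₀ + 1]) := by
    by_contra hc
    exact hnotQ ⟨l[t₀ + 1], List.getElem?_eq_getElem ht₁len, hc⟩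
  have hadj : hexGraph.Adj (l[t₀]) (l[t₀ + 1]) := γ.isChain.getElem t₀ ht₁len
  have hrow : rOf (l[t₀]) = Ht K N :=
    row_eq_Ht_of_adj_DownLow (γ.subset _ (List.getElem_mem ht₀len)) (hv₀ ▸ hv₀D) hv₁D hadj
  refine ⟨t₀, l.length - 1, ht₀lt, by omega, ?_, ?_⟩
  · show (0 : ℤ) + 2 ^ K * ((1 : ℕ) : ℤ) ≤ (l[t₀]).1 1
    have : (l[t₀]).1 1 = rOf (l[t₀]) := rfl
    rw [this, hrow]; unfold Ht; push_cast; omega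
  · show (l[l.length - 1]).1 1 ≤ (0 : ℤ) + ((1 : ℕ) : ℤ)
    rw [← List.getLast_eq_getElem hne, hlast]
    unfold yF; rw [fj_fst_one]; norm_num

/-! ### A walk exists: reachability inside `Λ ∖ {u}` and its conversion to a mid-edge SAW -/

/-- The vertex set `Λ ∖ {u}`. -/
def LamU (K N : ℕ) : Set HexVertex := {v | v ∈ Lam K N ∧ v ≠ uF}

theorem fj_mem_LamU {j r : ℤ} (h : InLam K N j r) (hu : ¬ (j = 1 ∧ r = 1)) : fj j r ∈ LamU K N := by
  refine ⟨fj_mem_Lam_iff.2 h, fun e => hu ?_⟩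
  unfold uF at e
  exact fj_inj.1 e

/-- `w` is joined to the foot `yF` inside `Λ ∖ {u}`. -/
theorem rch_wF_yF : (wF, yF N) ∈ RchRel (LamU K N) := by
  have h2K := @one_le_two_pow K
  have hBox : ∀ j r : ℤ, 0 ≤ r → r ≤ Ht K N - 1 → -(4 * N : ℤ) - 2 ≤ j → j ≤ 2 * N + 2 →
      ¬ (j = 1 ∧ r = 1) → fj j r ∈ LamU K N :=
    fun j r h1 h2 h3 h4 hu => fj_mem_LamU (Or.inl ⟨h1, h2, h3, h4⟩) hu
  have hTop : ∀ j : ℤ, -(4 * N : ℤ) - 2 ≤ j → j ≤ jD N + 1 → fj j (Ht K N) ∈ LamU K N :=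
    fun j h1 h2 => fj_mem_LamU (Or.inr (Or.inl ⟨rfl, h1, h2⟩)) (by unfold Ht; omega)
  have hDown : ∀ j r : ℤ, 0 ≤ r → r ≤ Ht K N → (j = jD N ∨ j = jD N + 1) → fj j r ∈ LamU K N :=
    fun j r h1 h2 h3 => fj_mem_LamU (Or.inr (Or.inr ⟨h1, h2, h3⟩)) (by unfold jD at h3; omega)
  -- w = (0,1) → (-1,1)
  have s1 : (fj 0 1, fj (-1) 1) ∈ RchRel (LamU K N) :=
    rch_symm (rch_of_adj (hBox _ _ (by norm_num) (by unfold Ht; omega) (by omega) (by omega) (by omega))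
      (hBox _ _ (by norm_num) (by unfold Ht; omega) (by omega) (by omega) (by omega))
      (by have := adj_fj_succ (-1) 1; simpa using this))
  -- (-1,1) up to (-1, Ht-1)
  obtain ⟨n, hn⟩ : ∃ n : ℕ, (n : ℤ) = Ht K N - 2 := ⟨(Ht K N - 2).toNat, by unfold Ht; omega⟩
  have s2 : (fj (-1) 1, fj (-1) (1 + n)) ∈ RchRel (LamU K N) :=
    rch_col_up (LamU K N) (by norm_num) 1 n
      (hBox _ _ (by norm_num) (by unfold Ht; omega) (by omega) (by omega) (by omega))
      fun i hi hi' => ⟨hBox _ _ (by omega) (by omega) (by omega) (by omega) (by omega),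
        hBox _ _ (by omega) (by omega) (by omega) (by omega) (by omega)⟩
  rw [hn, show (1 : ℤ) + (Ht K N - 2) = Ht K N - 1 by ring] at s2
  -- (-1, Ht-1) → (-2, Ht)
  have s3 : (fj (-1) (Ht K N - 1), fj (-2) (Ht K N)) ∈ RchRel (LamU K N) :=
    rch_of_adj (hBox _ _ (by unfold Ht; omega) le_rfl (by omega) (by omega) (by unfold Ht; omega))
      (hTop _ (by omega) (by unfold jD; omega))
      (by have := adj_fj_up (j := -1) (by norm_num) (Ht K N - 1)
          simpa [sub_add_cancel] using this)
  -- along the top row to (jD, Ht)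
  have s4 : (fj (-2) (Ht K N), fj (jD N) (Ht K N)) ∈ RchRel (LamU K N) :=
    rch_row (LamU K N) (Ht K N) (-2) (jD N) (by unfold jD; omega) fun i hi hi' =>
      hTop i (by omega) (by omega)
  -- down the column to (jD, 0)
  obtain ⟨n', hn'⟩ : ∃ n' : ℕ, (n' : ℤ) = Ht K N := ⟨(Ht K N).toNat, by unfold Ht; omega⟩
  have s5 : (fj (jD N) (Ht K N), fj (jD N) (Ht K N - n')) ∈ RchRel (LamU K N) :=
    rch_col_down (LamU K N) jD_even (Ht K N) n' (hDown _ _ (by unfold Ht; omega) le_rfl (Or.inl rfl))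
      fun i hi hi' => ⟨hDown _ _ (by omega) (by omega) (Or.inl rfl),
        hDown _ _ (by omega) (by omega) (Or.inr rfl)⟩
  rw [hn', sub_self] at s5
  exact rch_trans (rch_trans (rch_trans (rch_trans s1 s2) s3) s4) s5

/-- **A mid-edge SAW from the source to the target exists.** -/
theorem nonempty_saw : Nonempty (HexMidEdgeSAW (Lam K N) s(uF, wF) (zF N)) := by
  obtain ⟨hw, hy, ⟨p⟩⟩ := rch_wF_yF (K := K) (N := N)
  set q := p.toPath with hq
  set l : List HexVertex := q.1.support.map Subtype.val with hl
  have hlS : ∀ v ∈ l, v ∈ LamU K N := by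
    intro v hv
    obtain ⟨x, -, rfl⟩ := List.mem_map.1 hv
    exact x.2
  have hnd : l.Nodup := (q.2.support_nodup).map Subtype.val_injective
  have hch : l.IsChain hexGraph.Adj := by
    rw [hl, List.isChain_map]
    exact (q.1.isChain_adj_support).imp fun a b h => h
  have hne : l ≠ [] := by rw [hl]; simp
  have hhead : l.head? = some wF := by
    rw [hl, ← SimpleGraph.Walk.cons_tail_support]; rfl
  have hlast : l.getLast? = some (yF N) := by
    rw [hl, List.getLast?_map, List.getLast?_eq_some_getLast (SimpleGraph.Walk.support_ne_nil _),
      Option.map_some, SimpleGraph.Walk.getLast_support]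
  have hu : uF ∉ l := fun h => (hlS _ h).2 rfl
  have hy' : yF' N ∉ l := fun h => yF'_not_mem (hlS _ h).1
  set E := List.zipWith (fun u w => s(u, w)) l l.tail with hE
  have haE : s(uF, wF) ∉ E := fun h => hu (forall_mem_of_mem_edges l _ h uF (Sym2.mem_mk_left _ _))
  have hzE : zF N ∉ E := fun h =>
    hy' (forall_mem_of_mem_edges l _ h (yF' N) (by unfold zF; exact Sym2.mem_mk_right _ _))
  refine ⟨{ verts := l
            subset := fun v hv => (hlS v hv).1
            nodup := hnd
            isChain := hch
            head_mem := fun v hv => ?_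
            getLast_mem := fun v hv => ?_
            eq_of_nil := fun h => (hne h).elim
            edges_nodup := fun _ => ?_
            fst_mem := a_mem_midEdges }⟩
  · rw [hhead, Option.some_inj] at hv
    subst hv
    exact Sym2.mem_mk_right _ _
  · rw [hlast, Option.some_inj] at hv
    rw [← hv]; unfold zF; exact Sym2.mem_mk_left _ _
  · have hEn : E.Nodup := edges_nodup hnd
    refine List.nodup_append.2 ⟨List.nodup_cons.2 ⟨haE, hEn⟩, List.nodup_singleton _, ?_⟩
    intro e he f hf
    rw [List.mem_singleton] at hf
    subst hf
    rcases List.mem_cons.1 he with rfl | he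
    · exact a_ne_zF
    · rintro rfl; exact hzE he

/-! ### `RootRenewal` is false -/

/-- **`RootRenewal` (the typed a-priori input of crux idea `root-renewal-kesten`) IS FALSE.** -/
theorem not_rootRenewal : ¬ RootRenewal := by
  intro h
  obtain ⟨K, hK⟩ := h (1 / 2) (by norm_num)
  obtain ⟨R₀, hR₀, H⟩ := hK 1 le_rfl
  set N : ℕ := ⌈R₀⌉₊ with hN
  have hRN : R₀ ≤ N := Nat.le_ceil R₀
  have := H (Lam K N) 0 uF wF (zF N) simplyConnected_Lam adj_uF_wF wF_mem row_wF
    (fun v hv => patch_clause hRN v hv) zF_mem_midEdges (fun v hv => far_clause hRN v hv)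
  exact rr_ineq_false_of_forcedU forcedU (Z_pos_of_nonempty nonempty_saw)
    (by norm_num : (1 / 2 : ℝ) < 1) this

end Instance

end RootRenewalDefects

/-! ## §13 Planner aid (cycle 2): the orientation-complete hypothesis `R6`, typed and pre-audited

The triage panel and §8 recommend re-typing item 14003's two ball clauses with INDEPENDENT lattice
orientations.  `HexObservableLimitR6` below is that statement, written so that it ELABORATES and so
that its co-oriented instance `k = (0, 0)` is `R`'s body up to two `simp` rewrites
(`obsLimitR6Body_zero_iff`).  Orientation index `k : Fin 6`, unit `ζ^k` (`triZeta ^ k`), flat piece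
`FlatAt D i (ζ^{k i}) ρ`, and the exact half-lattice clause in the row family cut by that piece:
`k = 0`: `m ≤ x₁` (R's clause); `k = 3`: `x₁ ≤ m`; `k = 1 / 4`: family `x₀` with `x₀ ≤ m` /
`m ≤ x₀`; `k = 2 / 5`: family `x₀ + x₁ + t` with `≤ m` / `m ≤` (signs from `im(ζ̄^k · triEmbed)`).
Consequences (checked): `obsLimitR_of_R6 : R6 → R` (so `R6` is the STRONGER hypothesis and the crux
over `R6` is the WEAKER item, `cruxR6_of_crux`), and under `R6` the orientation silence of §8
disappears by fiat (every one of the 36 classes is an instance).  Not checked here (and not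
checkable by a refuter): that `R6` is true — it is DCS Conjecture 2, ψ-averaged, for flat pieces in
the six lattice directions; it is immune to the corridor witness of item 5420 for the same reason `R`
is (the root ball stays rigid), and mirror symmetry still forces `c ∈ ℝ`. -/

/-- Card 3's three zigzag row coordinates of a honeycomb vertex `v = (x, t)`: horizontal rows
`x 1`, `60°`-rows `x 0`, `120°`-rows `x 0 + x 1 + t`. -/
def rowCoord (i : Fin 3) (v : HexVertex) : ℤ :=
  if i = 0 then v.1 1 else if i = 1 then v.1 0 else v.1 0 + v.1 1 + (v.2 : ℕ)

/-- Row family cut by a flat piece of orientation `ζ^k`. -/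
def orientFamily : Fin 6 → Fin 3 := ![0, 1, 2, 0, 1, 2]

/-- Side of the half-lattice clause for orientation `ζ^k` (`+1`: `m ≤ rowCoord`, `−1`: `rowCoord ≤ m`). -/
def orientSign : Fin 6 → ℤ := ![1, -1, -1, -1, 1, 1]

/-- At `k = 0` the oriented clause is `R`'s clause `m ≤ v.1 1`. -/
theorem orientClause_zero_iff (m : ℤ) (v : HexVertex) :
    orientSign 0 * m ≤ orientSign 0 * rowCoord (orientFamily 0) v ↔ m ≤ v.1 1 := by
  simp [orientSign, orientFamily, rowCoord]

/-- At `k = 0` the oriented flat piece is `R`'s flat piece. -/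
theorem flatAt_zeta_zero_iff (D : DobrushinDomain) (i : Fin 2) (ρ : ℝ) :
    FlatAt D i (triZeta ^ ((0 : Fin 6) : ℕ)) ρ ↔
      D.carrier ∩ Metric.ball (D.pt i) ρ = {z : ℂ | (D.pt i).im < z.im} ∩ Metric.ball (D.pt i) ρ := by
  rw [Fin.val_zero, pow_zero]
  exact flatAt_one_iff D i ρ

/-- The per-domain body of the orientation-complete hypothesis at orientation pair `k`. -/
def ObsLimitR6Body (k : Fin 2 → Fin 6) (c : ℂ) (D : DobrushinDomain) : Prop :=
  ∀ (ρ : ℝ) (Λ : ℝ → Finset HexVertex) (m : Fin 2 → ℝ → ℤ) (a b : ℝ → Sym2 HexVertex)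
    (Φ : ConformalEquiv D.carrier UpperHalfPlane.upperHalfPlaneSet) (L : ℂ → ℂ) (Lb : ℂ) (ψ : ℂ → ℂ),
    let F : ℝ → Sym2 HexVertex → ℂ := fun δ z =>
      hexParafermionicObservable (Λ δ) (a δ) hexCriticalFugacity (5 / 8) z
    0 < ρ →
    (∀ i : Fin 2, FlatAt D i (triZeta ^ ((k i : Fin 6) : ℕ)) ρ) →
    (∀ᶠ δ : ℝ in nhdsWithin 0 (Set.Ioi 0),
      hexDomainSimplyConnected (Λ δ) ∧ a δ ∈ hexDomainBoundary (Λ δ) ∧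
        b δ ∈ hexDomainBoundary (Λ δ) ∧ Nonempty (HexMidEdgeSAW (Λ δ) (a δ) (b δ)) ∧
        (hexGraph.induce ((Λ δ : Finset HexVertex) : Set HexVertex)).Preconnected ∧
        (∀ v ∈ Λ δ, (δ : ℂ) * hexCenter v ∈ D.carrier) ∧
        (∀ i : Fin 2, ∀ v : HexVertex, (δ : ℂ) * hexCenter v ∈ Metric.ball (D.pt i) ρ →
          (v ∈ Λ δ ↔ orientSign (k i) * m i δ ≤ orientSign (k i) * rowCoord (orientFamily (k i)) v))) →
    (∀ K : Set ℂ, IsCompact K → K ⊆ D.carrier → ∀ᶠ δ : ℝ in nhdsWithin 0 (Set.Ioi 0),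
      ∀ v : HexVertex, (δ : ℂ) * hexCenter v ∈ K → v ∈ Λ δ) →
    Tendsto (fun δ : ℝ => (δ : ℂ) * hexMidpoint (a δ)) (nhdsWithin 0 (Set.Ioi 0)) (nhds (D.pt 0)) →
    Tendsto (fun δ : ℝ => (δ : ℂ) * hexMidpoint (b δ)) (nhdsWithin 0 (Set.Ioi 0)) (nhds (D.pt 1)) →
    Tendsto (fun x => ‖Φ x‖) (nhdsWithin (D.pt 0) D.carrier) atTop →
    Φ.HasBoundaryValue (D.pt 1) 0 →
    ContinuousOn L D.carrier → (∀ z ∈ D.carrier, Complex.exp (L z) = deriv Φ z) →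
    Tendsto L (nhdsWithin (D.pt 1) D.carrier) (nhds Lb) →
    Continuous ψ → HasCompactSupport ψ → tsupport ψ ⊆ D.carrier →
    Tendsto (fun δ : ℝ => (δ : ℂ) ^ 2 * (∑ᶠ e ∈ hexDomainMidEdges (Λ δ),
      ψ ((δ : ℂ) * hexMidpoint e) * F δ e) / F δ (b δ)) (nhdsWithin 0 (Set.Ioi 0))
      (nhds (c * ∫ z, ψ z * Complex.exp ((5 / 8 : ℂ) * (L z - Lb))))

/-- **`R6`** — `HexObservableLimitR` with independent lattice orientations at the two marked
points (ONE universal constant `c` for all 36 classes). -/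
def HexObservableLimitR6 : Prop :=
  ∃ c : ℂ, c ≠ 0 ∧ ∀ (k : Fin 2 → Fin 6) (D : DobrushinDomain), ObsLimitR6Body k c D

/-- The co-oriented body `k ≡ 0` IS `R`'s body (two `simp` rewrites under the binders). -/
theorem obsLimitR6Body_zero_iff (c : ℂ) (D : DobrushinDomain) :
    ObsLimitR6Body (fun _ => 0) c D ↔ ObsLimitRBody c D := by
  constructor
  · intro h ρ Λ m a b Φ L Lb ψ _ hρ hflat hdisc hK ha hb hΦ hΦb hL hexp hLb hψ hψK hψD
    refine h ρ Λ m a b Φ L Lb ψ hρ (fun i => (flatAt_zeta_zero_iff D i ρ).2 (hflat i)) ?_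
      hK ha hb hΦ hΦb hL hexp hLb hψ hψK hψD
    exact hdisc.mono fun δ hd => ⟨hd.1, hd.2.1, hd.2.2.1, hd.2.2.2.1, hd.2.2.2.2.1, hd.2.2.2.2.2.1,
      fun i v hv => (hd.2.2.2.2.2.2 i v hv).trans (orientClause_zero_iff _ _).symm⟩
  · intro h ρ Λ m a b Φ L Lb ψ _ hρ hflat hdisc hK ha hb hΦ hΦb hL hexp hLb hψ hψK hψD
    refine h ρ Λ m a b Φ L Lb ψ hρ (fun i => (flatAt_zeta_zero_iff D i ρ).1 (hflat i)) ?_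
      hK ha hb hΦ hΦb hL hexp hLb hψ hψK hψD
    exact hdisc.mono fun δ hd => ⟨hd.1, hd.2.1, hd.2.2.1, hd.2.2.2.1, hd.2.2.2.2.1, hd.2.2.2.2.2.1,
      fun i v hv => (hd.2.2.2.2.2.2 i v hv).trans (orientClause_zero_iff _ _)⟩

/-- `R6 → R`: the orientation-complete hypothesis is the STRONGER one. -/
theorem obsLimitR_of_R6 (h : HexObservableLimitR6) : SAWDefectDecoherence.HexObservableLimitR := by
  obtain ⟨c, hc, H⟩ := h
  exact obsLimitR_iff_body.2 ⟨c, hc, fun D => (obsLimitR6Body_zero_iff c D).1 (H _ D)⟩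

/-- Hence the crux re-filed over `R6` is the WEAKER item: the present crux implies it. -/
theorem cruxR6_of_crux (h : SAWDefectDecoherence.ObservableToSLER) :
    HexObservableLimitR6 → SAWDefectDecoherence.HexTight → SAWDevelopingMap.HexConjecture :=
  fun h6 hT => h (obsLimitR_of_R6 h6) hT

/-- … and `R6` does bind the classes where `R` is silent: e.g. at `k = (0, 3)` (floor at `a`, CEILING
at `b` — the strip-crossing configuration of DCS's own `S_T`) its flat premise is the relative class
`180°`, on which `ObsLimitRBody` holds vacuously (§8) while `ObsLimitR6Body` is a genuine instance. -/
theorem flatAt_zeta_three (D : DobrushinDomain) (i : Fin 2) (ρ : ℝ) :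
    FlatAt D i (triZeta ^ ((3 : Fin 6) : ℕ)) ρ ↔ FlatAt D i (-1) ρ := by
  have h3 : triZeta ^ ((3 : Fin 6) : ℕ) = -1 := by
    show triZeta ^ 3 = -1
    unfold triZeta
    rw [← Complex.exp_nat_mul]
    have : (3 : ℕ) * (Real.pi * Complex.I / 3) = Real.pi * Complex.I := by push_cast; ring
    rw [this, Complex.exp_pi_mul_I]
  rw [h3]

end Summit.CriticalPhenomena.SAWScalingLimit.Cruxes.ObservableToSLER.Disproof
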